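import Mathlib
import Literature.NumberTheory.LFunctions.Zhang2022.Section4GaussianWeight
import Literature.Analysis.Complex.RectangleResiduePolarParts
import Literature.Analysis.Complex.VerticalLineShift
import HarnessLib

/-!
# The Landau rectangle for the Gaussian Perron kernel `K(s) = Y^{s+β}ω₁(s+β)/(s+β)` — contour
# bookkeeping with explicit constants (the step "we move the contour … in the same way as in the
# proof of Lemma 8.4" of Zhang (2022) §15 (15.15), §16 (16.10), §15 p. 87)

Topic `Literature/NumberTheory/LFunctions/Zhang2022` (Landau–Siegel audit tree; verdict-neutral).
Y. Zhang, *Discrete mean estimates and the Landau–Siegel zero*, arXiv:2211.02515v1 (2022)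
[Zhang2022LandauSiegel] — **an unrefereed manuscript under adjudication**. This file contains NO claim of
the manuscript: it is the character-free complex analysis behind three of its displays, all of the shape
`(2πi)⁻¹∫_{(σ₀)} Φ(s)·Y^{s+β}ω₁(s+β)(s+β)⁻¹ ds = Σ residues + (error)` with `ω₁(w) = exp{w²/(4Λ)}` the
Gaussian of §4 (4.1) (`GaussWeight.omega1`): (15.15)–(15.16) [Z22 p.85, tex L4218–4224]
(`Φ = ζ(1+s+β₁)ζ(1+s+β₂)ℳ₁(d,l;1+s)/(ζ(1+s)L(1+s,χ))·d^{−s}`, `Y = P₄`, `β = β₃`), (16.10)–(16.11)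
[Z22 p.92, tex L4550–4556] (`Y = P₄`, `β = β₂`) and §15 p.87, tex L4359 (`Y = T`, `β = 0`), each moved
"in the same way as in the proof of Lemma 8.4", i.e. (proof of Lemma 8.2, [Z22 p.44]) to LANDAU'S
broken line: the vertical segment `Re s = a`, `|t| ≤ H` inside the zero-free region, the two horizontal
segments `Im s = ±H`, and the two tails of the original line `Re s = σ₀`, `|t| ≥ H`.

It is the twin, for the Gaussian kernel, of the tree's bookkeeping file for the exponential Perron kernel
`e^{uL}/u²` (`Zhang2022.Lemma84.integral_line_decomp`, `…norm_tails_le`, …, `Section8Lemma84Contour`):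

* `((Y : ℂ) ^ (s + β) * omega1 Λ (s + β) / (s + β)) = Y^{s+β}·ω₁(s+β)/(s+β)` and its size on vertical lines (`norm_kernel_line`,
  `norm_kernel_line_le`: `‖K(σ+it)‖ ≤ Y^{σ'}e^{σ'²/(4Λ)}|σ'|⁻¹·e^{−(t+b)²/(4Λ)}`, `σ' = σ + Re β`,
  `b = Im β`); its meromorphy: `K = kernelNum/(z+β)` with `kernelNum` entire (`differentiable_kernelNum`),
  `kernelNum(−β) = 1` (so `Res_{s=−β} Φ·K = Φ(−β)`), `differentiableAt_kernel` off `−β`;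
* for an integrand `G = Φ·K`: integrability on a vertical line from a bound on `Φ`
  (`integrable_line`), and the bounds for the four pieces of Landau's contour from sup-bounds of `Φ` on
  them — `norm_tails_le` (`|t| ≥ H` on `Re s = σ₀`: Gaussian tail `e^{−(H−|b|)²/(4Λ)}`), `norm_left_le`
  (the segment `Re s = a`: the factor `Y^{a'}`, which is the saving `(P₄/d)^{−c/𝓛} ≤ e^{−c𝓛^{1/10}}` of
  (15.15)), `norm_horizontal_le` (`Im s = ±H`: Gaussian factor again);
* `integral_line_eq_pieces` — the decomposition of `∫_ℝ G(σ₀+it)dt` into the pieces and the boundary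
  integral of the rectangle `[a, σ₀] × [−H, H]` (pure measure theory), and
* **`norm_lineIntegral_sub_residues_le`** — the assembled statement: if `G` is meromorphic on a
  neighbourhood of the closed rectangle with finitely many poles inside (pole data as in the tree's residue
  theorem `Literature.Analysis.Complex.rectBoundaryIntegral_eq_sum_of_poles`), then
  `‖(1/2π)∫_ℝ G(σ₀+it)dt − Σ_p Res_p G‖ ≤ (1/2π)·(tails + left + 2·horizontal)` with the three explicit
  bounds above.

The arithmetic input of the manuscript's steps (which poles lie in the rectangle, the zero-free region,
the size of `Φ` on the four pieces) is NOT here: it is supplied by the consumer as the hypotheses `S`,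
`M₀`, `M₁`, `M₂`. Nothing about Theorems 1–2 of the manuscript or about Landau–Siegel zeros is asserted.

## References

* Y. Zhang, arXiv:2211.02515v1 (2022), §15 (15.15)–(15.16) p.85; §16 (16.10)–(16.11) p.92; §15 p.87;
  §8 proof of Lemma 8.2 p.44 (the contour); §4 (4.1) (`ω₁`). [cite: Zhang2022LandauSiegel, §15 (15.15)]
* H. L. Montgomery, R. C. Vaughan, *Multiplicative Number Theory I*, CUP 2007, §5.1 (5.15)–(5.16)
  (kernels and weights), §6.2 (Landau's contour: proof of Theorem 6.9). [cite: MontgomeryVaughan2007, §6.2]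
* J. B. Conway, *Functions of One Complex Variable I*, GTM 11, Ch. V Thm 2.2 (residue theorem). [Conway1978]
-/

noncomputable section

open Complex Real Set MeasureTheory Filter Topology intervalIntegral
open scoped Interval

namespace Literature.NumberTheory.LFunctions.Zhang2022.GaussKernelContour

open GaussWeight

/-! ### The kernel and its size on vertical lines -/

/-- The Gaussian weight `e^{−u²/(4Λ)}` is `GaussWeight.gauss (4Λ)⁻¹ u`. [folklore] -/
private theorem exp_neg_sq_div_eq_gauss (Λ u : ℝ) : rexp (-u ^ 2 / (4 * Λ)) = gauss (4 * Λ)⁻¹ u := by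
  rw [gauss]; congr 1; ring

/-- `∫_ℝ e^{−u²/(4Λ)} du = √(4πΛ)`. [folklore] -/
private theorem integral_gauss_inv (Λ : ℝ) : ∫ u, gauss (4 * Λ)⁻¹ u = Real.sqrt (4 * π * Λ) := by
  rw [integral_gauss]; congr 1; rw [div_inv_eq_mul]; ring

/-- On the line `s = σ + it`: `s + β = σ' + it'` with `σ' = σ + Re β`, `t' = t + Im β`. [folklore] -/
private theorem line_add_eq (σ t : ℝ) (β : ℂ) :
    (σ : ℂ) + t * I + β = ((σ + β.re : ℝ) : ℂ) + ((t + β.im : ℝ) : ℂ) * I := by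
  apply Complex.ext <;> simp

/-- **Size of the kernel on a vertical line** (exact): for `Y > 0`,
`‖K(σ+it)‖ = Y^{σ'}·exp{(σ'² − t'²)/(4Λ)}/‖σ' + it'‖` (`σ' = σ + Re β`, `t' = t + Im β`).
[cite: MontgomeryVaughan2007, §5.1 (5.15)–(5.16)] -/
theorem norm_kernel_line {Y : ℝ} (hY : 0 < Y) (Λ : ℝ) (β : ℂ) (σ t : ℝ) :
    ‖((Y : ℂ) ^ ((σ : ℂ) + t * I + β) * omega1 Λ ((σ : ℂ) + t * I + β) / ((σ : ℂ) + t * I + β))‖ =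
      Y ^ (σ + β.re) * rexp (((σ + β.re) ^ 2 - (t + β.im) ^ 2) / (4 * Λ)) /
        ‖((σ + β.re : ℝ) : ℂ) + ((t + β.im : ℝ) : ℂ) * I‖ := by
  rw [line_add_eq, norm_div, norm_mul, norm_omega1,
    Complex.norm_cpow_eq_rpow_re_of_pos hY]
  simp

/-- **Size of the kernel on a vertical line** (bound): for `Y > 0` and `σ' = σ + Re β ≠ 0`,
`‖K(σ+it)‖ ≤ Y^{σ'}e^{σ'²/(4Λ)}|σ'|⁻¹ · e^{−(t + Im β)²/(4Λ)}`. [cite: MontgomeryVaughan2007, §6.2] -/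
theorem norm_kernel_line_le {Y : ℝ} (hY : 0 < Y) (Λ : ℝ) (β : ℂ) {σ : ℝ} (hσ : σ + β.re ≠ 0) (t : ℝ) :
    ‖((Y : ℂ) ^ ((σ : ℂ) + t * I + β) * omega1 Λ ((σ : ℂ) + t * I + β) / ((σ : ℂ) + t * I + β))‖ ≤
      Y ^ (σ + β.re) * rexp ((σ + β.re) ^ 2 / (4 * Λ)) / |σ + β.re| *
        gauss (4 * Λ)⁻¹ (t + β.im) := by
  rw [norm_kernel_line hY]
  set σ' := σ + β.re
  set t' := t + β.im
  have hnorm : |σ'| ≤ ‖((σ' : ℝ) : ℂ) + ((t' : ℝ) : ℂ) * I‖ := by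
    simpa using Complex.abs_re_le_norm (((σ' : ℝ) : ℂ) + ((t' : ℝ) : ℂ) * I)
  have hσ' : 0 < |σ'| := abs_pos.mpr hσ
  have hsplit : rexp ((σ' ^ 2 - t' ^ 2) / (4 * Λ)) =
      rexp (σ' ^ 2 / (4 * Λ)) * gauss (4 * Λ)⁻¹ t' := by
    rw [← exp_neg_sq_div_eq_gauss, ← Real.exp_add]; congr 1; ring
  rw [hsplit]
  have hA : 0 ≤ Y ^ σ' * (rexp (σ' ^ 2 / (4 * Λ)) * gauss (4 * Λ)⁻¹ t') := by
    have := (gauss_pos (4 * Λ)⁻¹ t').le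
    positivity
  calc Y ^ σ' * (rexp (σ' ^ 2 / (4 * Λ)) * gauss (4 * Λ)⁻¹ t') /
        ‖((σ' : ℝ) : ℂ) + ((t' : ℝ) : ℂ) * I‖
      ≤ Y ^ σ' * (rexp (σ' ^ 2 / (4 * Λ)) * gauss (4 * Λ)⁻¹ t') / |σ'| :=
        div_le_div_of_nonneg_left hA hσ' hnorm
    _ = _ := by ring


/-! ### The kernel as a meromorphic function: its numerator, its only pole `s = −β` -/

/-- `K(z) = (Y^{z+β}ω₁(z+β))/(z − (−β))^{0+1}`: the kernel of §4 (4.1) has a single simple pole, at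
`s = −β`, with the entire numerator `Y^{z+β}ω₁(z+β)` — the pole datum of `K` in the format of the tree's
residue theorem `Literature.Analysis.Complex.rectBoundaryIntegral_eq_sum_of_poles`.
[cite: Zhang2022LandauSiegel, §4 (4.1) pp.17–18] -/
theorem kernel_eq_num_div (Λ Y : ℝ) (β z : ℂ) :
    (Y : ℂ) ^ (z + β) * omega1 Λ (z + β) / (z + β) =
      ((Y : ℂ) ^ (z + β) * omega1 Λ (z + β)) / (z - (-β)) ^ (0 + 1) := by
  simp [sub_neg_eq_add]

/-- The numerator takes the value `1` at `s = −β` (`Y⁰ = ω₁(0) = 1`): the residue of `Φ·K` at the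
kernel's pole is `Φ(−β)` (as in §4: the residue of `x^wω₁(w)/w` at `w = 0` is `1`).
[cite: Zhang2022LandauSiegel, §4 (4.1) pp.17–18] -/
theorem kernel_num_at_neg (Λ Y : ℝ) (β : ℂ) : (Y : ℂ) ^ (-β + β) * omega1 Λ (-β + β) = 1 := by
  simp [omega1]

/-- The numerator `Y^{s+β}ω₁(s+β)` is an entire function of `s` (`Y > 0`).
[cite: Zhang2022LandauSiegel, §4 (4.1) pp.17–18] -/
theorem differentiable_kernel_num {Y : ℝ} (hY : 0 < Y) (Λ : ℝ) (β : ℂ) :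
    Differentiable ℂ (fun s : ℂ => (Y : ℂ) ^ (s + β) * omega1 Λ (s + β)) := by
  have hY0 : (Y : ℂ) ≠ 0 := ofReal_ne_zero.mpr hY.ne'
  intro s
  have h1 : DifferentiableAt ℂ (fun s : ℂ => (Y : ℂ) ^ (s + β)) s :=
    ((differentiableAt_id.add_const β).const_cpow (Or.inl hY0))
  have h2 : DifferentiableAt ℂ (fun s : ℂ => omega1 Λ (s + β)) s := by
    unfold omega1
    fun_prop
  exact h1.mul h2

/-- The kernel `Y^{s+β}ω₁(s+β)/(s+β)` is complex differentiable at every `s ≠ −β` (`Y > 0`).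
[cite: Zhang2022LandauSiegel, §4 (4.1) pp.17–18] -/
theorem differentiableAt_kernel {Y : ℝ} (hY : 0 < Y) (Λ : ℝ) {β s : ℂ} (hs : s + β ≠ 0) :
    DifferentiableAt ℂ (fun s : ℂ => (Y : ℂ) ^ (s + β) * omega1 Λ (s + β) / (s + β)) s :=
  (differentiable_kernel_num hY Λ β s).div (differentiableAt_id.add_const β) hs

/-! ### Two Gaussian integrals -/

/-- **Shifted Gaussian tail**: for `|c| ≤ H`, `∫_{t>H} e^{−Λ₀(t+c)²}dt ≤ e^{−Λ₀(H−|c|)²}·½√(π/Λ₀)`.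
[folklore] -/
private theorem setIntegral_gauss_shift_Ioi_le {Λ₀ : ℝ} (hΛ₀ : 0 < Λ₀) {H c : ℝ} (hc : |c| ≤ H) :
    ∫ t in Ioi H, gauss Λ₀ (t + c) ≤ gauss Λ₀ (H - |c|) * (Real.sqrt (π / Λ₀) / 2) := by
  have hmp : MeasurePreserving (fun v : ℝ => v + c) volume volume := measurePreserving_add_right volume c
  have hme : MeasurableEmbedding (fun v : ℝ => v + c) := (Homeomorph.addRight c).measurableEmbedding
  have hpre : (fun v : ℝ => v + c) ⁻¹' Ioi (H + c) = Ioi H := by ext v; simp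
  have h1 : ∫ t in Ioi H, gauss Λ₀ (t + c) = ∫ u in Ioi (H + c), gauss Λ₀ u := by
    rw [← hpre, hmp.setIntegral_preimage_emb hme]
  have hHc : 0 ≤ H + c := by have := neg_abs_le c; linarith
  have h0 : 0 ≤ H - |c| := by linarith
  have hle : H - |c| ≤ H + c := by have := neg_abs_le c; linarith
  have hmono : gauss Λ₀ (H + c) ≤ gauss Λ₀ (H - |c|) := by
    rw [gauss, gauss]
    refine Real.exp_le_exp.mpr ?_
    have : (H - |c|) ^ 2 ≤ (H + c) ^ 2 := by nlinarith
    nlinarith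
  rw [h1]
  calc ∫ u in Ioi (H + c), gauss Λ₀ u ≤ gauss Λ₀ (H + c) * (Real.sqrt (π / Λ₀) / 2) :=
        integral_gauss_Ioi_le hΛ₀ hHc
    _ ≤ gauss Λ₀ (H - |c|) * (Real.sqrt (π / Λ₀) / 2) :=
        mul_le_mul_of_nonneg_right hmono (by positivity)

/-- `½√(π/(4Λ)⁻¹) = √(πΛ)`… in the form used below: `√(π/(4Λ)⁻¹) = √(4πΛ)`. [folklore] -/
private theorem sqrt_pi_div_inv (Λ : ℝ) : Real.sqrt (π / (4 * Λ)⁻¹) = Real.sqrt (4 * π * Λ) := by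
  congr 1; rw [div_inv_eq_mul]; ring

/-! ### The integrand `G = Φ·K` on vertical lines: integrability and the pieces of Landau's contour -/

section Pieces

variable {Λ Y : ℝ} {β : ℂ} {Φ : ℂ → ℂ}

/-- `σ + it + β ≠ 0` when `σ + Re β ≠ 0`. [folklore] -/
private theorem line_add_ne_zero {σ : ℝ} (hσ : σ + β.re ≠ 0) (t : ℝ) : (σ : ℂ) + t * I + β ≠ 0 := by
  intro h
  exact hσ (by simpa using congrArg Complex.re h)

/-- The kernel is continuous along a vertical line `Re s = σ` with `σ + Re β ≠ 0` (`Y > 0`).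
[cite: Zhang2022LandauSiegel, §4 (4.1) pp.17–18] -/
theorem continuous_kernel_line (hY : 0 < Y) (Λ : ℝ) {σ : ℝ} (hσ : σ + β.re ≠ 0) :
    Continuous fun t : ℝ => ((Y : ℂ) ^ ((σ : ℂ) + t * I + β) * omega1 Λ ((σ : ℂ) + t * I + β) / ((σ : ℂ) + t * I + β)) := by
  have hY0 : (Y : ℂ) ≠ 0 := ofReal_ne_zero.mpr hY.ne'
  have hcpow : Continuous fun b : ℂ => (Y : ℂ) ^ b :=
    continuous_iff_continuousAt.mpr fun b => continuousAt_const_cpow hY0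
  have hω : Continuous fun w : ℂ => omega1 Λ w := by unfold omega1; fun_prop
  refine Continuous.div ?_ (by fun_prop) (line_add_ne_zero hσ)
  exact (hcpow.comp (by fun_prop)).mul (hω.comp (by fun_prop))

/-- **Integrability on a vertical line**: if `Φ` is continuous along `Re s = σ` (`σ + Re β ≠ 0`) with
`‖Φ(σ+it)‖ ≤ M`, then `t ↦ Φ(σ+it)K(σ+it)` is integrable (it is dominated by a Gaussian).
[cite: MontgomeryVaughan2007, §5.1 (5.15)–(5.16)] -/
theorem integrable_line (hΛ : 0 < Λ) (hY : 0 < Y) {σ M : ℝ} (hσ : σ + β.re ≠ 0)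
    (hcont : Continuous fun t : ℝ => Φ ((σ : ℂ) + t * I))
    (hΦ : ∀ t : ℝ, ‖Φ ((σ : ℂ) + t * I)‖ ≤ M) :
    Integrable fun t : ℝ => Φ ((σ : ℂ) + t * I) *
        ((Y : ℂ) ^ ((σ : ℂ) + t * I + β) * omega1 Λ ((σ : ℂ) + t * I + β) / ((σ : ℂ) + t * I + β)) := by
  have hΛ₀ : 0 < (4 * Λ)⁻¹ := by positivity
  have hM : 0 ≤ M := le_trans (norm_nonneg _) (hΦ 0)
  set C₀ : ℝ := Y ^ (σ + β.re) * rexp ((σ + β.re) ^ 2 / (4 * Λ)) / |σ + β.re| with hC₀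
  have hC₀0 : 0 ≤ C₀ := by rw [hC₀]; positivity
  have hgi : Integrable fun t : ℝ => M * C₀ * gauss (4 * Λ)⁻¹ (t + β.im) :=
    (((integrable_gauss hΛ₀).comp_add_right β.im).const_mul (M * C₀))
  refine hgi.mono' (hcont.mul (continuous_kernel_line hY Λ hσ)).aestronglyMeasurable
    (Eventually.of_forall fun t => ?_)
  rw [norm_mul]
  calc ‖Φ ((σ : ℂ) + t * I)‖ * ‖((Y : ℂ) ^ ((σ : ℂ) + t * I + β) * omega1 Λ ((σ : ℂ) + t * I + β) / ((σ : ℂ) + t * I + β))‖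
      ≤ M * (C₀ * gauss (4 * Λ)⁻¹ (t + β.im)) :=
        mul_le_mul (hΦ t) (norm_kernel_line_le hY Λ β hσ t) (norm_nonneg _) hM
    _ = M * C₀ * gauss (4 * Λ)⁻¹ (t + β.im) := by ring

/-- **The two tails** on `Re s = σ₀` (`σ₀' = σ₀ + Re β ≠ 0`): if `‖Φ(σ₀+it)‖ ≤ M` for `|t| ≥ H`,
`H ≥ |Im β|`, then `‖∫_{t>H} ΦK‖ + ‖∫_{t<−H} ΦK‖ ≤
2·M·Y^{σ₀'}e^{σ₀'²/(4Λ)}|σ₀'|⁻¹·e^{−(H−|Im β|)²/(4Λ)}·½√(4πΛ)`. [cite: MontgomeryVaughan2007, §6.2] -/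
theorem norm_tails_le (hΛ : 0 < Λ) (hY : 0 < Y) {σ₀ M H : ℝ} (hσ₀ : σ₀ + β.re ≠ 0)
    (hH : |β.im| ≤ H) (hM : 0 ≤ M)
    (hΦ : ∀ t : ℝ, H ≤ |t| → ‖Φ ((σ₀ : ℂ) + t * I)‖ ≤ M) :
    ‖∫ t in Ioi H, Φ ((σ₀ : ℂ) + t * I) *
        ((Y : ℂ) ^ ((σ₀ : ℂ) + t * I + β) * omega1 Λ ((σ₀ : ℂ) + t * I + β) / ((σ₀ : ℂ) + t * I + β))‖ +
      ‖∫ t in Iic (-H), Φ ((σ₀ : ℂ) + t * I) *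
          ((Y : ℂ) ^ ((σ₀ : ℂ) + t * I + β) * omega1 Λ ((σ₀ : ℂ) + t * I + β) / ((σ₀ : ℂ) + t * I + β))‖ ≤
      2 * (M * (Y ^ (σ₀ + β.re) * rexp ((σ₀ + β.re) ^ 2 / (4 * Λ)) / |σ₀ + β.re|) *
        (gauss (4 * Λ)⁻¹ (H - |β.im|) * (Real.sqrt (4 * π * Λ) / 2))) := by
  have hΛ₀ : 0 < (4 * Λ)⁻¹ := by positivity
  have hH0 : 0 ≤ H := le_trans (abs_nonneg _) hH
  set C₀ : ℝ := Y ^ (σ₀ + β.re) * rexp ((σ₀ + β.re) ^ 2 / (4 * Λ)) / |σ₀ + β.re| with hC₀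
  have hC₀0 : 0 ≤ C₀ := by rw [hC₀]; positivity
  -- pointwise bound for `|t| ≥ H`
  have hpt : ∀ t : ℝ, H ≤ |t| →
      ‖Φ ((σ₀ : ℂ) + t * I) *
          ((Y : ℂ) ^ ((σ₀ : ℂ) + t * I + β) * omega1 Λ ((σ₀ : ℂ) + t * I + β) / ((σ₀ : ℂ) + t * I + β))‖ ≤
        M * C₀ * gauss (4 * Λ)⁻¹ (t + β.im) := by
    intro t ht
    rw [norm_mul]
    calc ‖Φ ((σ₀ : ℂ) + t * I)‖ * ‖((Y : ℂ) ^ ((σ₀ : ℂ) + t * I + β) * omega1 Λ ((σ₀ : ℂ) + t * I + β) / ((σ₀ : ℂ) + t * I + β))‖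
        ≤ M * (C₀ * gauss (4 * Λ)⁻¹ (t + β.im)) :=
          mul_le_mul (hΦ t ht) (norm_kernel_line_le hY Λ β hσ₀ t) (norm_nonneg _) hM
      _ = M * C₀ * gauss (4 * Λ)⁻¹ (t + β.im) := by ring
  -- the Gaussian majorants on `Ioi H`, for the shifts `+Im β` and `−Im β`
  have hgi : ∀ c : ℝ, IntegrableOn (fun t : ℝ => M * C₀ * gauss (4 * Λ)⁻¹ (t + c)) (Ioi H) :=
    fun c => (((integrable_gauss hΛ₀).comp_add_right c).const_mul (M * C₀)).integrableOn
  have hgint : ∀ c : ℝ, |c| ≤ H → ∫ t in Ioi H, M * C₀ * gauss (4 * Λ)⁻¹ (t + c) ≤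
      M * C₀ * (gauss (4 * Λ)⁻¹ (H - |c|) * (Real.sqrt (4 * π * Λ) / 2)) := by
    intro c hc
    rw [MeasureTheory.integral_const_mul, ← sqrt_pi_div_inv]
    exact mul_le_mul_of_nonneg_left (setIntegral_gauss_shift_Ioi_le hΛ₀ hc) (by positivity)
  -- upper tail
  have hup : ‖∫ t in Ioi H, Φ ((σ₀ : ℂ) + t * I) *
      ((Y : ℂ) ^ ((σ₀ : ℂ) + t * I + β) * omega1 Λ ((σ₀ : ℂ) + t * I + β) / ((σ₀ : ℂ) + t * I + β))‖ ≤
      M * C₀ * (gauss (4 * Λ)⁻¹ (H - |β.im|) * (Real.sqrt (4 * π * Λ) / 2)) := by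
    have hbound : ∀ᵐ t : ℝ ∂(volume.restrict (Ioi H)),
        ‖Φ ((σ₀ : ℂ) + t * I) *
            ((Y : ℂ) ^ ((σ₀ : ℂ) + t * I + β) * omega1 Λ ((σ₀ : ℂ) + t * I + β) / ((σ₀ : ℂ) + t * I + β))‖ ≤
          M * C₀ * gauss (4 * Λ)⁻¹ (t + β.im) := by
      refine (ae_restrict_iff' measurableSet_Ioi).2 (Eventually.of_forall fun t (ht : H < t) => ?_)
      exact hpt t (by rw [abs_of_nonneg (hH0.trans ht.le)]; exact ht.le)
    exact (norm_integral_le_of_norm_le (hgi β.im) hbound).trans (hgint β.im hH)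
  -- lower tail (reflect `t ↦ −t`)
  have hlow : ‖∫ t in Iic (-H), Φ ((σ₀ : ℂ) + t * I) *
      ((Y : ℂ) ^ ((σ₀ : ℂ) + t * I + β) * omega1 Λ ((σ₀ : ℂ) + t * I + β) / ((σ₀ : ℂ) + t * I + β))‖ ≤
      M * C₀ * (gauss (4 * Λ)⁻¹ (H - |β.im|) * (Real.sqrt (4 * π * Λ) / 2)) := by
    rw [← integral_comp_neg_Ioi]
    have hbound : ∀ᵐ t : ℝ ∂(volume.restrict (Ioi H)),
        ‖Φ ((σ₀ : ℂ) + ((-t : ℝ) : ℂ) * I) *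
            ((Y : ℂ) ^ ((σ₀ : ℂ) + ((-t : ℝ) : ℂ) * I + β) * omega1 Λ ((σ₀ : ℂ) + ((-t : ℝ) : ℂ) * I + β) / ((σ₀ : ℂ) + ((-t : ℝ) : ℂ) * I + β))‖ ≤
          M * C₀ * gauss (4 * Λ)⁻¹ (t + (-β.im)) := by
      refine (ae_restrict_iff' measurableSet_Ioi).2 (Eventually.of_forall fun t (ht : H < t) => ?_)
      have h := hpt (-t) (by rw [abs_neg, abs_of_nonneg (hH0.trans ht.le)]; exact ht.le)
      have hg : gauss (4 * Λ)⁻¹ (-t + β.im) = gauss (4 * Λ)⁻¹ (t + -β.im) := by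
        rw [← gauss_neg]; congr 1; ring
      rwa [hg] at h
    have h2 := (norm_integral_le_of_norm_le (hgi (-β.im)) hbound).trans
      (hgint (-β.im) (by rwa [abs_neg]))
    rwa [abs_neg] at h2
  have : M * C₀ * (gauss (4 * Λ)⁻¹ (H - |β.im|) * (Real.sqrt (4 * π * Λ) / 2)) =
      M * (Y ^ (σ₀ + β.re) * rexp ((σ₀ + β.re) ^ 2 / (4 * Λ)) / |σ₀ + β.re|) *
        (gauss (4 * Λ)⁻¹ (H - |β.im|) * (Real.sqrt (4 * π * Λ) / 2)) := by rw [hC₀]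
  linarith

/-- **The left segment** `Re s = a`, `|t| ≤ H` (`a' = a + Re β ≠ 0`): if `‖Φ(a+it)‖ ≤ M` there, then
`‖∫_{−H}^{H} Φ(a+it)K(a+it)dt‖ ≤ M·Y^{a'}e^{a'²/(4Λ)}|a'|⁻¹·√(4πΛ)`. In (15.15) `Y^{a'}` with
`a' = −c/𝓛`, `Y = P₄/d > T` is the saving `e^{−c𝓛^{1/10}}`. [cite: MontgomeryVaughan2007, §6.2] -/
theorem norm_left_le (hΛ : 0 < Λ) (hY : 0 < Y) {a M H : ℝ} (ha : a + β.re ≠ 0) (hH : 0 ≤ H)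
    (hM : 0 ≤ M) (hΦ : ∀ t : ℝ, |t| ≤ H → ‖Φ ((a : ℂ) + t * I)‖ ≤ M) :
    ‖∫ t in (-H)..H, Φ ((a : ℂ) + t * I) *
        ((Y : ℂ) ^ ((a : ℂ) + t * I + β) * omega1 Λ ((a : ℂ) + t * I + β) / ((a : ℂ) + t * I + β))‖ ≤
      M * (Y ^ (a + β.re) * rexp ((a + β.re) ^ 2 / (4 * Λ)) / |a + β.re|) *
        Real.sqrt (4 * π * Λ) := by
  have hΛ₀ : 0 < (4 * Λ)⁻¹ := by positivity
  set C₀ : ℝ := Y ^ (a + β.re) * rexp ((a + β.re) ^ 2 / (4 * Λ)) / |a + β.re| with hC₀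
  have hC₀0 : 0 ≤ C₀ := by rw [hC₀]; positivity
  have hHH : -H ≤ H := by linarith
  set g : ℝ → ℝ := fun t => M * C₀ * gauss (4 * Λ)⁻¹ (t + β.im) with hg
  have hgi : Integrable g := ((integrable_gauss hΛ₀).comp_add_right β.im).const_mul (M * C₀)
  have hb : ∀ᵐ t : ℝ, t ∈ Ioc (-H) H →
      ‖Φ ((a : ℂ) + t * I) *
          ((Y : ℂ) ^ ((a : ℂ) + t * I + β) * omega1 Λ ((a : ℂ) + t * I + β) / ((a : ℂ) + t * I + β))‖ ≤ g t := by
    refine Eventually.of_forall fun t ht => ?_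
    have htH : |t| ≤ H := abs_le.2 ⟨ht.1.le, ht.2⟩
    rw [norm_mul, hg]
    calc ‖Φ ((a : ℂ) + t * I)‖ * ‖((Y : ℂ) ^ ((a : ℂ) + t * I + β) * omega1 Λ ((a : ℂ) + t * I + β) / ((a : ℂ) + t * I + β))‖
        ≤ M * (C₀ * gauss (4 * Λ)⁻¹ (t + β.im)) :=
          mul_le_mul (hΦ t htH) (norm_kernel_line_le hY Λ β ha t) (norm_nonneg _) hM
      _ = M * C₀ * gauss (4 * Λ)⁻¹ (t + β.im) := by ring
  have h1 := intervalIntegral.norm_integral_le_of_norm_le hHH hb hgi.intervalIntegrable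
  refine h1.trans ?_
  rw [intervalIntegral.integral_of_le hHH]
  calc ∫ t in Ioc (-H) H, g t ≤ ∫ t, g t :=
        setIntegral_le_integral hgi (Eventually.of_forall fun t => by
          simp only [hg]; exact mul_nonneg (mul_nonneg hM hC₀0) (gauss_pos _ _).le)
    _ = M * C₀ * Real.sqrt (4 * π * Λ) := by
        simp only [hg]
        rw [MeasureTheory.integral_const_mul]
        erw [integral_add_right_eq_self (fun u => gauss (4 * Λ)⁻¹ u) β.im]
        rw [integral_gauss_inv]
    _ = _ := by rw [hC₀]


/-- **The kernel on a horizontal segment** `s = u + iT'`, `a ≤ u ≤ σ₀`, at a height `|T'| > |Im β|`: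
`‖K(u+iT')‖ ≤ max(Y^{a'},Y^{σ₀'})·e^{max(a'²,σ₀'²)/(4Λ)}·e^{−(|T'|−|Im β|)²/(4Λ)}/(|T'| − |Im β|)`.
[cite: MontgomeryVaughan2007, §6.2] -/
theorem norm_kernel_horizontal_le (hΛ : 0 < Λ) (hY : 0 < Y) {a σ₀ T' : ℝ} (hT : |β.im| < |T'|)
    {u : ℝ} (hau : a ≤ u) (huσ : u ≤ σ₀) :
    ‖((Y : ℂ) ^ ((u : ℂ) + T' * I + β) * omega1 Λ ((u : ℂ) + T' * I + β) / ((u : ℂ) + T' * I + β))‖ ≤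
      max (Y ^ (a + β.re)) (Y ^ (σ₀ + β.re)) *
        rexp (max ((a + β.re) ^ 2) ((σ₀ + β.re) ^ 2) / (4 * Λ)) *
        gauss (4 * Λ)⁻¹ (|T'| - |β.im|) / (|T'| - |β.im|) := by
  rw [norm_kernel_line hY]
  set u' := u + β.re with hu'
  set t' := T' + β.im with ht'
  set d := |T'| - |β.im| with hd
  have hd0 : 0 < d := by rw [hd]; linarith
  -- `|t'| ≥ |T'| − |Im β| = d`
  have ht'd : d ≤ |t'| := by
    have h1 : |T'| ≤ |T' + β.im| + |β.im| := by
      have := abs_sub (T' + β.im) β.im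
      rwa [add_sub_cancel_right] at this
    rw [hd, ht']; linarith
  -- the denominator
  have hden : d ≤ ‖((u' : ℝ) : ℂ) + ((t' : ℝ) : ℂ) * I‖ := by
    refine ht'd.trans ?_
    simpa using Complex.abs_im_le_norm (((u' : ℝ) : ℂ) + ((t' : ℝ) : ℂ) * I)
  -- the power of `Y`
  have hYpow : Y ^ u' ≤ max (Y ^ (a + β.re)) (Y ^ (σ₀ + β.re)) := by
    rcases le_total 1 Y with h1 | h1
    · exact le_max_of_le_right (Real.rpow_le_rpow_of_exponent_le h1 (by rw [hu']; linarith))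
    · exact le_max_of_le_left (Real.rpow_le_rpow_of_exponent_ge hY h1 (by rw [hu']; linarith))
  -- the Gaussian factor
  have hsq : u' ^ 2 ≤ max ((a + β.re) ^ 2) ((σ₀ + β.re) ^ 2) := by
    rcases le_or_gt 0 u' with h0 | h0
    · exact le_max_of_le_right (by rw [hu'] at h0 ⊢; nlinarith)
    · exact le_max_of_le_left (by rw [hu'] at h0 ⊢; nlinarith)
  have hgauss : gauss (4 * Λ)⁻¹ t' ≤ gauss (4 * Λ)⁻¹ d := by
    rw [gauss, gauss]
    refine Real.exp_le_exp.mpr ?_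
    have hΛ₀ : 0 < (4 * Λ)⁻¹ := by positivity
    have : d ^ 2 ≤ t' ^ 2 := by
      rw [← sq_abs t']
      exact pow_le_pow_left₀ hd0.le ht'd 2
    nlinarith
  have hexp : rexp ((u' ^ 2 - t' ^ 2) / (4 * Λ)) ≤
      rexp (max ((a + β.re) ^ 2) ((σ₀ + β.re) ^ 2) / (4 * Λ)) * gauss (4 * Λ)⁻¹ d := by
    have hsplit : rexp ((u' ^ 2 - t' ^ 2) / (4 * Λ)) =
        rexp (u' ^ 2 / (4 * Λ)) * gauss (4 * Λ)⁻¹ t' := by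
      rw [← exp_neg_sq_div_eq_gauss, ← Real.exp_add]; congr 1; ring
    rw [hsplit]
    refine mul_le_mul ?_ hgauss (gauss_pos _ _).le (Real.exp_nonneg _)
    exact Real.exp_le_exp.mpr (div_le_div_of_nonneg_right hsq (by positivity))
  have hnum : Y ^ u' * rexp ((u' ^ 2 - t' ^ 2) / (4 * Λ)) ≤
      max (Y ^ (a + β.re)) (Y ^ (σ₀ + β.re)) *
        (rexp (max ((a + β.re) ^ 2) ((σ₀ + β.re) ^ 2) / (4 * Λ)) * gauss (4 * Λ)⁻¹ d) :=
    mul_le_mul hYpow hexp (Real.exp_nonneg _) ((Real.rpow_nonneg hY.le _).trans hYpow)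
  calc Y ^ u' * rexp ((u' ^ 2 - t' ^ 2) / (4 * Λ)) / ‖((u' : ℝ) : ℂ) + ((t' : ℝ) : ℂ) * I‖
      ≤ max (Y ^ (a + β.re)) (Y ^ (σ₀ + β.re)) *
          (rexp (max ((a + β.re) ^ 2) ((σ₀ + β.re) ^ 2) / (4 * Λ)) * gauss (4 * Λ)⁻¹ d) / d :=
        div_le_div₀ (by have := (gauss_pos (4 * Λ)⁻¹ d).le; positivity) hnum hd0 hden
    _ = _ := by ring

/-- **The horizontal sides** `Im s = T'` (`|T'| > |Im β|`), `a ≤ Re s ≤ σ₀`: if `‖Φ(u+iT')‖ ≤ M` on the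
segment, then `‖∫_a^{σ₀} Φ(u+iT')K(u+iT')du‖ ≤
(σ₀−a)·M·max(Y^{a'},Y^{σ₀'})e^{max(a'²,σ₀'²)/(4Λ)}·e^{−(|T'|−|Im β|)²/(4Λ)}/(|T'|−|Im β|)`.
[cite: MontgomeryVaughan2007, §6.2] -/
theorem norm_horizontal_le (hΛ : 0 < Λ) (hY : 0 < Y) {a σ₀ T' M : ℝ} (haσ : a ≤ σ₀)
    (hT : |β.im| < |T'|) (hM : 0 ≤ M)
    (hΦ : ∀ u : ℝ, a ≤ u → u ≤ σ₀ → ‖Φ ((u : ℂ) + T' * I)‖ ≤ M) :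
    ‖∫ u in a..σ₀, Φ ((u : ℂ) + T' * I) *
        ((Y : ℂ) ^ ((u : ℂ) + T' * I + β) * omega1 Λ ((u : ℂ) + T' * I + β) / ((u : ℂ) + T' * I + β))‖ ≤
      (σ₀ - a) * (M * (max (Y ^ (a + β.re)) (Y ^ (σ₀ + β.re)) *
        rexp (max ((a + β.re) ^ 2) ((σ₀ + β.re) ^ 2) / (4 * Λ)) *
        gauss (4 * Λ)⁻¹ (|T'| - |β.im|) / (|T'| - |β.im|))) := by
  have hb : ∀ u ∈ Ι a σ₀, ‖Φ ((u : ℂ) + T' * I) *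
      ((Y : ℂ) ^ ((u : ℂ) + T' * I + β) * omega1 Λ ((u : ℂ) + T' * I + β) / ((u : ℂ) + T' * I + β))‖ ≤
      M * (max (Y ^ (a + β.re)) (Y ^ (σ₀ + β.re)) *
        rexp (max ((a + β.re) ^ 2) ((σ₀ + β.re) ^ 2) / (4 * Λ)) *
        gauss (4 * Λ)⁻¹ (|T'| - |β.im|) / (|T'| - |β.im|)) := by
    intro u hu
    rw [uIoc_of_le haσ] at hu
    rw [norm_mul]
    exact mul_le_mul (hΦ u hu.1.le hu.2) (norm_kernel_horizontal_le hΛ hY hT hu.1.le hu.2)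
      (norm_nonneg _) hM
  have h := intervalIntegral.norm_integral_le_of_norm_le_const hb
  rw [abs_of_nonneg (by linarith : 0 ≤ σ₀ - a)] at h
  linarith [h]

end Pieces

/-! ### The decomposition of the line integral and the assembled contour shift -/

/-- **Truncating the line `Re s = σ₀` at height `H` against the rectangle `[a, σ₀] × [−H, H]`**: for `Θ`
integrable along the line,
`∫_ℝ Θ(σ₀+it)dt = ∫_{t≤−H} + ∫_{t>H} + ∫_{−H}^{H}Θ(a+it)dt + i∫_a^{σ₀}Θ(u−iH)du − i∫_a^{σ₀}Θ(u+iH)du − i∮_{∂R}Θ`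
(the four-term boundary integral `Literature.Analysis.Complex.rectBoundaryIntegral`, convention
bottom − top + i·right − i·left). Pure measure theory (the tree's `Zhang2022.Lemma84.integral_line_decomp`
with a general left abscissa `a`). [cite: MontgomeryVaughan2007, §6.2] -/
theorem integral_line_eq_pieces {Θ : ℂ → ℂ} (a σ₀ H : ℝ)
    (hint : Integrable fun t : ℝ => Θ ((σ₀ : ℂ) + t * I)) :
    ∫ t : ℝ, Θ ((σ₀ : ℂ) + t * I) =
      (∫ t in Iic (-H), Θ ((σ₀ : ℂ) + t * I)) + (∫ t in Ioi H, Θ ((σ₀ : ℂ) + t * I)) +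
      (∫ t in (-H)..H, Θ ((a : ℂ) + t * I)) +
      I * (∫ u in a..σ₀, Θ ((u : ℂ) + ((-H : ℝ) : ℂ) * I)) -
      I * (∫ u in a..σ₀, Θ ((u : ℂ) + (H : ℂ) * I)) -
      I * Literature.Analysis.Complex.rectBoundaryIntegral Θ a σ₀ (-H) H := by
  have hsplit1 := intervalIntegral.integral_Iic_add_Ioi (b := -H) hint.integrableOn hint.integrableOn
  have hsplit2 := intervalIntegral.integral_interval_add_Ioi (a := -H) (b := H) hint.integrableOn
    hint.integrableOn
  rw [← hsplit1, ← hsplit2, Literature.Analysis.Complex.rectBoundaryIntegral_def]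
  have hI : I * I = -1 := I_mul_I
  linear_combination ((∫ y : ℝ in (-H)..H, Θ ((σ₀ : ℂ) + ↑y * I)) -
    ∫ y : ℝ in (-H)..H, Θ ((a : ℂ) + ↑y * I)) * hI

section Assembly

variable {Λ Y : ℝ} {β : ℂ} {Φ : ℂ → ℂ}

/-- **The contour shift to Landau's broken line, with explicit error.** Let `G(s) = Φ(s)·K(s)`,
`K(s) = Y^{s+β}ω₁(s+β)/(s+β)` (`Λ, Y > 0`), `a < σ₀`, `H > |Im β|`, `a' = a + Re β ≠ 0`,
`σ₀' = σ₀ + Re β ≠ 0`. Suppose `G` is complex differentiable on an open neighbourhood `U` of the closed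
rectangle `R = [a, σ₀] × [−H, H]` except at a finite set `S` of interior points, at each of which
`G = φ_p/(z−p)^{n(p)+1}` near `p` with `φ_p` differentiable near `p` (the pole data of the tree's residue
theorem `Literature.Analysis.Complex.rectBoundaryIntegral_eq_sum_of_poles`), that `t ↦ G(σ₀+it)` is
integrable, and that `‖Φ‖ ≤ M₀` on the tails `Re s = σ₀, |t| ≥ H`, `‖Φ‖ ≤ M₁` on the left side `Re s = a,
|t| ≤ H`, `‖Φ‖ ≤ M₂` on the horizontal sides `Im s = ±H`. Then
`‖(1/2π)∫_ℝ G(σ₀+it)dt − Σ_{p∈S} Res_p G‖ ≤ (1/2π)·(E_tails + E_left + 2E_horiz)` with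
`E_tails = 2M₀Y^{σ₀'}e^{σ₀'²/(4Λ)}|σ₀'|⁻¹e^{−(H−|Im β|)²/(4Λ)}·½√(4πΛ)`,
`E_left = M₁Y^{a'}e^{a'²/(4Λ)}|a'|⁻¹√(4πΛ)`,
`E_horiz = (σ₀−a)M₂·max(Y^{a'},Y^{σ₀'})e^{max(a'²,σ₀'²)/(4Λ)}e^{−(H−|Im β|)²/(4Λ)}/(H−|Im β|)`
(`(1/2π)∫_ℝ G(σ₀+it)dt = (2πi)⁻¹∫_{(σ₀)} G(s)ds`; `Res_p G = ((swap dslope p)^[n p] φ_p)(p)`, `= φ_p(p)` at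
a simple pole). This is the step "we move the contour … in the same way as in the proof of Lemma 8.4" of
(15.15), (16.10) and §15 p.87, with the manuscript's inputs (poles, zero-free region, sizes) left as
hypotheses. [cite: Zhang2022LandauSiegel, §15 (15.15) p.85] [cite: MontgomeryVaughan2007, §6.2] -/
theorem norm_lineIntegral_sub_residues_le (hΛ : 0 < Λ) (hY : 0 < Y) {a σ₀ H M₀ M₁ M₂ : ℝ}
    (haσ : a < σ₀) (hH : |β.im| < H) (ha : a + β.re ≠ 0) (hσ₀ : σ₀ + β.re ≠ 0)
    (hM₀ : 0 ≤ M₀) (hM₁ : 0 ≤ M₁) (hM₂ : 0 ≤ M₂)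
    (hΦ₀ : ∀ t : ℝ, H ≤ |t| → ‖Φ ((σ₀ : ℂ) + t * I)‖ ≤ M₀)
    (hΦ₁ : ∀ t : ℝ, |t| ≤ H → ‖Φ ((a : ℂ) + t * I)‖ ≤ M₁)
    (hΦ₂ : ∀ u : ℝ, a ≤ u → u ≤ σ₀ →
      ‖Φ ((u : ℂ) + (H : ℂ) * I)‖ ≤ M₂ ∧ ‖Φ ((u : ℂ) + ((-H : ℝ) : ℂ) * I)‖ ≤ M₂)
    (hint : Integrable fun t : ℝ => Φ ((σ₀ : ℂ) + t * I) *
        ((Y : ℂ) ^ ((σ₀ : ℂ) + t * I + β) * omega1 Λ ((σ₀ : ℂ) + t * I + β) / ((σ₀ : ℂ) + t * I + β)))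
    (S : Finset ℂ) (n : ℂ → ℕ) (φ : ℂ → ℂ → ℂ) (U : Set ℂ) (hU : IsOpen U)
    (hKU : Icc a σ₀ ×ℂ Icc (-H) H ⊆ U) (hS : (S : Set ℂ) ⊆ Ioo a σ₀ ×ℂ Ioo (-H) H)
    (hG : DifferentiableOn ℂ (fun s => Φ s *
        ((Y : ℂ) ^ (s + β) * omega1 Λ (s + β) / (s + β))) (U \ ↑S))
    (hpole : ∀ p ∈ S, ∃ V ∈ 𝓝 p, DifferentiableOn ℂ (φ p) V ∧
        ∀ z ∈ V, z ≠ p → Φ z *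
            ((Y : ℂ) ^ (z + β) * omega1 Λ (z + β) / (z + β)) = φ p z / (z - p) ^ (n p + 1)) :
    ‖(1 / (2 * π) : ℂ) * (∫ t : ℝ, Φ ((σ₀ : ℂ) + t * I) *
        ((Y : ℂ) ^ ((σ₀ : ℂ) + t * I + β) * omega1 Λ ((σ₀ : ℂ) + t * I + β) / ((σ₀ : ℂ) + t * I + β))) -
        ∑ p ∈ S, (Function.swap dslope p)^[n p] (φ p) p‖ ≤
      1 / (2 * π) *
        (2 * (M₀ * (Y ^ (σ₀ + β.re) * rexp ((σ₀ + β.re) ^ 2 / (4 * Λ)) / |σ₀ + β.re|) *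
            (gauss (4 * Λ)⁻¹ (H - |β.im|) * (Real.sqrt (4 * π * Λ) / 2))) +
          M₁ * (Y ^ (a + β.re) * rexp ((a + β.re) ^ 2 / (4 * Λ)) / |a + β.re|) *
            Real.sqrt (4 * π * Λ) +
          2 * ((σ₀ - a) * (M₂ * (max (Y ^ (a + β.re)) (Y ^ (σ₀ + β.re)) *
            rexp (max ((a + β.re) ^ 2) ((σ₀ + β.re) ^ 2) / (4 * Λ)) *
            gauss (4 * Λ)⁻¹ (H - |β.im|) / (H - |β.im|))))) := by
  have hH0 : 0 < H := lt_of_le_of_lt (abs_nonneg _) hH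
  have hHH : -H < H := by linarith
  -- the residue theorem on the rectangle
  have hres := Literature.Analysis.Complex.rectBoundaryIntegral_eq_sum_of_poles haσ hHH S
    (fun s => Φ s * ((Y : ℂ) ^ (s + β) * omega1 Λ (s + β) / (s + β))) n φ U hU hKU hS hG hpole
  -- the decomposition of the line
  have hdec := integral_line_eq_pieces (Θ := fun s => Φ s *
      ((Y : ℂ) ^ (s + β) * omega1 Λ (s + β) / (s + β))) a σ₀ H hint
  -- names for the pieces
  set A := ∫ t in Iic (-H), Φ ((σ₀ : ℂ) + t * I) *
      ((Y : ℂ) ^ ((σ₀ : ℂ) + t * I + β) * omega1 Λ ((σ₀ : ℂ) + t * I + β) / ((σ₀ : ℂ) + t * I + β)) with hA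
  set B := ∫ t in Ioi H, Φ ((σ₀ : ℂ) + t * I) *
      ((Y : ℂ) ^ ((σ₀ : ℂ) + t * I + β) * omega1 Λ ((σ₀ : ℂ) + t * I + β) / ((σ₀ : ℂ) + t * I + β)) with hB
  set L := ∫ t in (-H)..H, Φ ((a : ℂ) + t * I) *
      ((Y : ℂ) ^ ((a : ℂ) + t * I + β) * omega1 Λ ((a : ℂ) + t * I + β) / ((a : ℂ) + t * I + β)) with hL
  set bot := ∫ u in a..σ₀, Φ ((u : ℂ) + ((-H : ℝ) : ℂ) * I) *
    ((Y : ℂ) ^ ((u : ℂ) + ((-H : ℝ) : ℂ) * I + β) * omega1 Λ ((u : ℂ) + ((-H : ℝ) : ℂ) * I + β) / ((u : ℂ) + ((-H : ℝ) : ℂ) * I + β)) with hbot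
  set top := ∫ u in a..σ₀, Φ ((u : ℂ) + (H : ℂ) * I) *
      ((Y : ℂ) ^ ((u : ℂ) + (H : ℂ) * I + β) * omega1 Λ ((u : ℂ) + (H : ℂ) * I + β) / ((u : ℂ) + (H : ℂ) * I + β))
    with htop
  set res := ∑ p ∈ S, (Function.swap dslope p)^[n p] (φ p) p with hresdef
  have hπ : (π : ℂ) ≠ 0 := ofReal_ne_zero.mpr Real.pi_pos.ne'
  have key : (1 / (2 * π) : ℂ) *
        (∫ t : ℝ, Φ ((σ₀ : ℂ) + t * I) *
            ((Y : ℂ) ^ ((σ₀ : ℂ) + t * I + β) * omega1 Λ ((σ₀ : ℂ) + t * I + β) / ((σ₀ : ℂ) + t * I + β))) - res =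
      (1 / (2 * π) : ℂ) * (A + B + L + I * bot - I * top) := by
    rw [hdec, hres]
    field_simp
    have hI : I * I = -1 := I_mul_I
    linear_combination (-(2 : ℂ) * ↑π * res) * hI
  -- bounds for the pieces
  have htails := norm_tails_le (Φ := Φ) (β := β) hΛ hY hσ₀ hH.le hM₀ hΦ₀
  have hleft := norm_left_le (Φ := Φ) (β := β) hΛ hY ha hH0.le hM₁ hΦ₁
  have htop' := norm_horizontal_le (Φ := Φ) (β := β) (T' := H) hΛ hY haσ.le
    (by rwa [abs_of_pos hH0]) hM₂ (fun u h1 h2 => (hΦ₂ u h1 h2).1)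
  have hbot' := norm_horizontal_le (Φ := Φ) (β := β) (T' := -H) hΛ hY haσ.le
    (by rwa [abs_neg, abs_of_pos hH0]) hM₂ (fun u h1 h2 => (hΦ₂ u h1 h2).2)
  rw [abs_of_pos hH0] at htop'
  rw [abs_neg, abs_of_pos hH0] at hbot'
  -- assemble
  have hc : ‖(1 / (2 * π) : ℂ)‖ = 1 / (2 * π) := by
    rw [show (1 / (2 * π) : ℂ) = ((1 / (2 * π) : ℝ) : ℂ) by push_cast; rfl, Complex.norm_real,
      Real.norm_of_nonneg (by positivity)]
  have htri : ‖A + B + L + I * bot - I * top‖ ≤ ‖A‖ + ‖B‖ + ‖L‖ + ‖bot‖ + ‖top‖ := by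
    have h1 : ‖I * bot‖ = ‖bot‖ := by rw [norm_mul, Complex.norm_I, one_mul]
    have h2 : ‖I * top‖ = ‖top‖ := by rw [norm_mul, Complex.norm_I, one_mul]
    calc ‖A + B + L + I * bot - I * top‖ ≤ ‖A + B + L + I * bot‖ + ‖I * top‖ := norm_sub_le _ _
      _ ≤ ‖A + B + L‖ + ‖I * bot‖ + ‖I * top‖ := by gcongr; exact norm_add_le _ _
      _ ≤ ‖A + B‖ + ‖L‖ + ‖I * bot‖ + ‖I * top‖ := by gcongr; exact norm_add_le _ _
      _ ≤ ‖A‖ + ‖B‖ + ‖L‖ + ‖I * bot‖ + ‖I * top‖ := by gcongr; exact norm_add_le _ _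
      _ = ‖A‖ + ‖B‖ + ‖L‖ + ‖bot‖ + ‖top‖ := by rw [h1, h2]
  rw [key, norm_mul, hc]
  refine mul_le_mul_of_nonneg_left (htri.trans ?_) (by positivity)
  linarith [htails, hleft, htop', hbot']

end Assembly

/-! ### The equality form, the pointwise integrand bound, and the simple-pole corollary

(Names of record of the lane's library queue, HOME/LIB-QUEUE.md Q-16: `integral_line_eq_sum_residues_add_remainder`,
`norm_integrand_line_le`, `integrable_integrand_line`, `…_of_simplePoles`.) -/

section EqualityForm

variable {Λ Y : ℝ} {β : ℂ} {Φ : ℂ → ℂ}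

/-- **Pointwise size of the integrand on a vertical line**: if `‖Φ(σ+it)‖ ≤ M` (`σ' = σ + Re β ≠ 0`,
`Y > 0`) then `‖Φ(σ+it)K(σ+it)‖ ≤ M·Y^{σ'}e^{σ'²/(4Λ)}|σ'|⁻¹·e^{−(t+Im β)²/(4Λ)}`.
[cite: MontgomeryVaughan2007, §6.2] -/
theorem norm_integrand_line_le (hY : 0 < Y) (Λ : ℝ) {σ M : ℝ} (hσ : σ + β.re ≠ 0) {t : ℝ}
    (hΦ : ‖Φ ((σ : ℂ) + t * I)‖ ≤ M) :
    ‖Φ ((σ : ℂ) + t * I) *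
        ((Y : ℂ) ^ ((σ : ℂ) + t * I + β) * omega1 Λ ((σ : ℂ) + t * I + β) / ((σ : ℂ) + t * I + β))‖ ≤
      M * (Y ^ (σ + β.re) * rexp ((σ + β.re) ^ 2 / (4 * Λ)) / |σ + β.re|) *
        gauss (4 * Λ)⁻¹ (t + β.im) := by
  have hM : 0 ≤ M := le_trans (norm_nonneg _) hΦ
  rw [norm_mul, mul_assoc]
  exact mul_le_mul hΦ (norm_kernel_line_le hY Λ β hσ t) (norm_nonneg _) hM

/-- **Integrability of the integrand on a vertical line** (the name of record; = `integrable_line`): `Φ`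
continuous along `Re s = σ` with `‖Φ(σ+it)‖ ≤ M`, `σ + Re β ≠ 0`, `Λ, Y > 0`.
[cite: MontgomeryVaughan2007, §5.1 (5.15)–(5.16)] -/
theorem integrable_integrand_line (hΛ : 0 < Λ) (hY : 0 < Y) {σ M : ℝ} (hσ : σ + β.re ≠ 0)
    (hcont : Continuous fun t : ℝ => Φ ((σ : ℂ) + t * I))
    (hΦ : ∀ t : ℝ, ‖Φ ((σ : ℂ) + t * I)‖ ≤ M) :
    Integrable fun t : ℝ => Φ ((σ : ℂ) + t * I) *
      ((Y : ℂ) ^ ((σ : ℂ) + t * I + β) * omega1 Λ ((σ : ℂ) + t * I + β) / ((σ : ℂ) + t * I + β)) :=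
  integrable_line hΛ hY hσ hcont hΦ

/-- **The contour shift as an identity** (no size hypotheses): under the pole data of
`Literature.Analysis.Complex.rectBoundaryIntegral_eq_sum_of_poles` for `G = Φ·K` on the rectangle
`[a, σ₀] × [−H, H]` and integrability of `G` along `Re s = σ₀`,
`(1/2π)∫_ℝ G(σ₀+it)dt = Σ_{p∈S} Res_p G + (1/2π)·(∫_{t≤−H}G(σ₀+it) + ∫_{t>H}G(σ₀+it) + ∫_{−H}^{H}G(a+it)
+ i∫_a^{σ₀}G(u−iH)du − i∫_a^{σ₀}G(u+iH)du)` — Landau's broken line: the residue theorem on the rectangle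
plus `integral_line_eq_pieces`. The remainder is bounded piece by piece by `norm_tails_le`, `norm_left_le`,
`norm_horizontal_le` (assembled: `norm_lineIntegral_sub_residues_le`).
[cite: Zhang2022LandauSiegel, §15 (15.15) p.85] [cite: MontgomeryVaughan2007, §6.2] -/
theorem integral_line_eq_sum_residues_add_remainder {a σ₀ H : ℝ} (haσ : a < σ₀) (hH : 0 < H)
    (hint : Integrable fun t : ℝ => Φ ((σ₀ : ℂ) + t * I) *
        ((Y : ℂ) ^ ((σ₀ : ℂ) + t * I + β) * omega1 Λ ((σ₀ : ℂ) + t * I + β) / ((σ₀ : ℂ) + t * I + β)))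
    (S : Finset ℂ) (n : ℂ → ℕ) (φ : ℂ → ℂ → ℂ) (U : Set ℂ) (hU : IsOpen U)
    (hKU : Icc a σ₀ ×ℂ Icc (-H) H ⊆ U) (hS : (S : Set ℂ) ⊆ Ioo a σ₀ ×ℂ Ioo (-H) H)
    (hG : DifferentiableOn ℂ (fun s => Φ s *
        ((Y : ℂ) ^ (s + β) * omega1 Λ (s + β) / (s + β))) (U \ ↑S))
    (hpole : ∀ p ∈ S, ∃ V ∈ 𝓝 p, DifferentiableOn ℂ (φ p) V ∧
        ∀ z ∈ V, z ≠ p → Φ z *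
            ((Y : ℂ) ^ (z + β) * omega1 Λ (z + β) / (z + β)) = φ p z / (z - p) ^ (n p + 1)) :
    (1 / (2 * π) : ℂ) * (∫ t : ℝ, Φ ((σ₀ : ℂ) + t * I) *
        ((Y : ℂ) ^ ((σ₀ : ℂ) + t * I + β) * omega1 Λ ((σ₀ : ℂ) + t * I + β) / ((σ₀ : ℂ) + t * I + β))) =
      ∑ p ∈ S, (Function.swap dslope p)^[n p] (φ p) p +
        (1 / (2 * π) : ℂ) *
          ((∫ t in Iic (-H), Φ ((σ₀ : ℂ) + t * I) *
              ((Y : ℂ) ^ ((σ₀ : ℂ) + t * I + β) * omega1 Λ ((σ₀ : ℂ) + t * I + β) /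
                ((σ₀ : ℂ) + t * I + β))) +
            (∫ t in Ioi H, Φ ((σ₀ : ℂ) + t * I) *
              ((Y : ℂ) ^ ((σ₀ : ℂ) + t * I + β) * omega1 Λ ((σ₀ : ℂ) + t * I + β) /
                ((σ₀ : ℂ) + t * I + β))) +
            (∫ t in (-H)..H, Φ ((a : ℂ) + t * I) *
              ((Y : ℂ) ^ ((a : ℂ) + t * I + β) * omega1 Λ ((a : ℂ) + t * I + β) /
                ((a : ℂ) + t * I + β))) +
            I * (∫ u in a..σ₀, Φ ((u : ℂ) + ((-H : ℝ) : ℂ) * I) *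
              ((Y : ℂ) ^ ((u : ℂ) + ((-H : ℝ) : ℂ) * I + β) * omega1 Λ ((u : ℂ) + ((-H : ℝ) : ℂ) * I + β) /
                ((u : ℂ) + ((-H : ℝ) : ℂ) * I + β))) -
            I * (∫ u in a..σ₀, Φ ((u : ℂ) + (H : ℂ) * I) *
              ((Y : ℂ) ^ ((u : ℂ) + (H : ℂ) * I + β) * omega1 Λ ((u : ℂ) + (H : ℂ) * I + β) /
                ((u : ℂ) + (H : ℂ) * I + β)))) := by
  have hHH : -H < H := by linarith
  have hres := Literature.Analysis.Complex.rectBoundaryIntegral_eq_sum_of_poles haσ hHH S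
    (fun s => Φ s * ((Y : ℂ) ^ (s + β) * omega1 Λ (s + β) / (s + β))) n φ U hU hKU hS hG hpole
  have hdec := integral_line_eq_pieces (Θ := fun s => Φ s *
      ((Y : ℂ) ^ (s + β) * omega1 Λ (s + β) / (s + β))) a σ₀ H hint
  set A := ∫ t in Iic (-H), Φ ((σ₀ : ℂ) + t * I) *
    ((Y : ℂ) ^ ((σ₀ : ℂ) + t * I + β) * omega1 Λ ((σ₀ : ℂ) + t * I + β) / ((σ₀ : ℂ) + t * I + β))
    with hA
  set B := ∫ t in Ioi H, Φ ((σ₀ : ℂ) + t * I) *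
    ((Y : ℂ) ^ ((σ₀ : ℂ) + t * I + β) * omega1 Λ ((σ₀ : ℂ) + t * I + β) / ((σ₀ : ℂ) + t * I + β))
    with hB
  set L := ∫ t in (-H)..H, Φ ((a : ℂ) + t * I) *
    ((Y : ℂ) ^ ((a : ℂ) + t * I + β) * omega1 Λ ((a : ℂ) + t * I + β) / ((a : ℂ) + t * I + β))
    with hL
  set bot := ∫ u in a..σ₀, Φ ((u : ℂ) + ((-H : ℝ) : ℂ) * I) *
    ((Y : ℂ) ^ ((u : ℂ) + ((-H : ℝ) : ℂ) * I + β) * omega1 Λ ((u : ℂ) + ((-H : ℝ) : ℂ) * I + β) /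
      ((u : ℂ) + ((-H : ℝ) : ℂ) * I + β)) with hbot
  set top := ∫ u in a..σ₀, Φ ((u : ℂ) + (H : ℂ) * I) *
    ((Y : ℂ) ^ ((u : ℂ) + (H : ℂ) * I + β) * omega1 Λ ((u : ℂ) + (H : ℂ) * I + β) /
      ((u : ℂ) + (H : ℂ) * I + β)) with htop
  set res := ∑ p ∈ S, (Function.swap dslope p)^[n p] (φ p) p with hresdef
  have hπ : (π : ℂ) ≠ 0 := ofReal_ne_zero.mpr Real.pi_pos.ne'
  rw [hdec, hres]
  field_simp
  have hI : I * I = -1 := I_mul_I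
  linear_combination (-(2 : ℂ) * ↑π * res) * hI

/-- **The contour shift with explicit error, all poles simple** (`n ≡ 0`): under the hypotheses of
`norm_lineIntegral_sub_residues_le` with `G = φ_p/(z − p)` near each `p ∈ S`,
`‖(1/2π)∫_ℝ G(σ₀+it)dt − Σ_{p∈S} φ_p(p)‖ ≤ (1/2π)·(E_tails + E_left + 2E_horiz)`. In (15.15) the poles
`−β₁, −β₂` (of `ζ(1+s+β₁)ζ(1+s+β₂)`), `−β₃` (of the kernel) and `ρ̃ − 1` (of `1/L(1+s,χ)`) are simple; in
(16.10) likewise `−β₁, −β₂, ρ̃ − 1`. [cite: Zhang2022LandauSiegel, §15 (15.15)–(15.16) p.85]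
[cite: MontgomeryVaughan2007, §6.2] -/
theorem norm_lineIntegral_sub_residues_le_of_simplePoles (hΛ : 0 < Λ) (hY : 0 < Y)
    {a σ₀ H M₀ M₁ M₂ : ℝ}
    (haσ : a < σ₀) (hH : |β.im| < H) (ha : a + β.re ≠ 0) (hσ₀ : σ₀ + β.re ≠ 0)
    (hM₀ : 0 ≤ M₀) (hM₁ : 0 ≤ M₁) (hM₂ : 0 ≤ M₂)
    (hΦ₀ : ∀ t : ℝ, H ≤ |t| → ‖Φ ((σ₀ : ℂ) + t * I)‖ ≤ M₀)
    (hΦ₁ : ∀ t : ℝ, |t| ≤ H → ‖Φ ((a : ℂ) + t * I)‖ ≤ M₁)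
    (hΦ₂ : ∀ u : ℝ, a ≤ u → u ≤ σ₀ →
      ‖Φ ((u : ℂ) + (H : ℂ) * I)‖ ≤ M₂ ∧ ‖Φ ((u : ℂ) + ((-H : ℝ) : ℂ) * I)‖ ≤ M₂)
    (hint : Integrable fun t : ℝ => Φ ((σ₀ : ℂ) + t * I) *
        ((Y : ℂ) ^ ((σ₀ : ℂ) + t * I + β) * omega1 Λ ((σ₀ : ℂ) + t * I + β) / ((σ₀ : ℂ) + t * I + β)))
    (S : Finset ℂ) (φ : ℂ → ℂ → ℂ) (U : Set ℂ) (hU : IsOpen U)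
    (hKU : Icc a σ₀ ×ℂ Icc (-H) H ⊆ U) (hS : (S : Set ℂ) ⊆ Ioo a σ₀ ×ℂ Ioo (-H) H)
    (hG : DifferentiableOn ℂ (fun s => Φ s *
        ((Y : ℂ) ^ (s + β) * omega1 Λ (s + β) / (s + β))) (U \ ↑S))
    (hpole : ∀ p ∈ S, ∃ V ∈ 𝓝 p, DifferentiableOn ℂ (φ p) V ∧
        ∀ z ∈ V, z ≠ p → Φ z *
            ((Y : ℂ) ^ (z + β) * omega1 Λ (z + β) / (z + β)) = φ p z / (z - p)) :
    ‖(1 / (2 * π) : ℂ) * (∫ t : ℝ, Φ ((σ₀ : ℂ) + t * I) *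
        ((Y : ℂ) ^ ((σ₀ : ℂ) + t * I + β) * omega1 Λ ((σ₀ : ℂ) + t * I + β) / ((σ₀ : ℂ) + t * I + β))) -
        ∑ p ∈ S, φ p p‖ ≤
      1 / (2 * π) *
        (2 * (M₀ * (Y ^ (σ₀ + β.re) * rexp ((σ₀ + β.re) ^ 2 / (4 * Λ)) / |σ₀ + β.re|) *
            (gauss (4 * Λ)⁻¹ (H - |β.im|) * (Real.sqrt (4 * π * Λ) / 2))) +
          M₁ * (Y ^ (a + β.re) * rexp ((a + β.re) ^ 2 / (4 * Λ)) / |a + β.re|) *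
            Real.sqrt (4 * π * Λ) +
          2 * ((σ₀ - a) * (M₂ * (max (Y ^ (a + β.re)) (Y ^ (σ₀ + β.re)) *
            rexp (max ((a + β.re) ^ 2) ((σ₀ + β.re) ^ 2) / (4 * Λ)) *
            gauss (4 * Λ)⁻¹ (H - |β.im|) / (H - |β.im|))))) := by
  have h := norm_lineIntegral_sub_residues_le (Φ := Φ) hΛ hY haσ hH ha hσ₀ hM₀ hM₁ hM₂ hΦ₀ hΦ₁ hΦ₂
    hint S (fun _ => 0) φ U hU hKU hS hG (fun p hp => by
      obtain ⟨V, hV, hφ, hGφ⟩ := hpole p hp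
      exact ⟨V, hV, hφ, fun z hz hzp => by rw [hGφ z hz hzp, zero_add, pow_one]⟩)
  simpa only [Function.iterate_zero, id_eq] using h

end EqualityForm

/-! ### Residues in the typed `limUnder` shape

The manuscript's residues are typed as punctured-neighbourhood limits — `Typed.Section15B.calR1 c′ χ j =
limUnder (𝓝[≠] (−βⱼ)) (s ↦ (s+βⱼ)·F(s))`, `Typed.Section16A.calR2` likewise (the L4 convention; closed forms
in `ResidueValues.calR1_one_eq` etc., `Section15ResidueLimits`). The following version of the contour shift
takes, at each pole, only the EXISTENCE of that limit and returns the residues in exactly that shape (the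
pole datum `φ_p` of the residue theorem is manufactured by Riemann's removable-singularity theorem,
Mathlib `Complex.differentiableOn_update_limUnder_of_bddAbove`). -/

section LimUnder

variable {Λ Y : ℝ} {β : ℂ} {Φ : ℂ → ℂ}

/-- **Simple-pole datum from a punctured limit.** If `G` is complex differentiable on `V ∖ {p}` for some
`V ∈ 𝓝 p` and `(z − p)·G(z) → r` as `z → p`, `z ≠ p`, then `φ := update (z ↦ (z−p)G(z)) p (lim)` is
differentiable on a neighbourhood `W` of `p`, `G = φ/(z − p)` on `W ∖ {p}`, and
`φ(p) = limUnder (𝓝[≠] p) (z ↦ (z−p)G(z)) = r` (Riemann's theorem on removable singularities).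
[cite: Conway1978, Ch. V Thm 1.2] -/
theorem exists_simplePole_datum_of_tendsto {G : ℂ → ℂ} {p r : ℂ} {V : Set ℂ} (hV : V ∈ 𝓝 p)
    (hG : DifferentiableOn ℂ G (V \ {p}))
    (hlim : Tendsto (fun z => (z - p) * G z) (𝓝[≠] p) (𝓝 r)) :
    ∃ W ∈ 𝓝 p, DifferentiableOn ℂ
        (Function.update (fun z => (z - p) * G z) p (limUnder (𝓝[≠] p) fun z => (z - p) * G z)) W ∧
      (∀ z ∈ W, z ≠ p → G z =
        Function.update (fun z => (z - p) * G z) p (limUnder (𝓝[≠] p) fun z => (z - p) * G z) z /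
          (z - p) ^ (0 + 1)) ∧
      Function.update (fun z => (z - p) * G z) p (limUnder (𝓝[≠] p) fun z => (z - p) * G z) p = r := by
  set f : ℂ → ℂ := fun z => (z - p) * G z with hf
  -- a ball inside `V` on whose puncture `f` is within `1` of `r`
  have hnear : ∀ᶠ z in 𝓝[≠] p, ‖f z - r‖ < 1 := by
    have := (Metric.tendsto_nhds.1 hlim) 1 one_pos
    exact this.mono fun z hz => by rwa [dist_eq_norm] at hz
  obtain ⟨U₁, hU₁, hU₁sub⟩ : ∃ U₁ ∈ 𝓝 p, ∀ z ∈ U₁ \ {p}, ‖f z - r‖ < 1 := by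
    rw [eventually_nhdsWithin_iff] at hnear
    obtain ⟨U₁, hU₁, hsub⟩ := eventually_iff_exists_mem.1 hnear
    exact ⟨U₁, hU₁, fun z hz => hsub z hz.1 hz.2⟩
  obtain ⟨δ, hδ, hball⟩ := Metric.mem_nhds_iff.1 (Filter.inter_mem hV hU₁)
  have hballV : Metric.ball p δ ⊆ V := fun z hz => (hball hz).1
  have hballU : Metric.ball p δ ⊆ U₁ := fun z hz => (hball hz).2
  -- `f` is differentiable on the punctured ball and bounded there
  have hfd : DifferentiableOn ℂ f (Metric.ball p δ \ {p}) := by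
    intro z hz
    have hGz := hG z ⟨hballV hz.1, hz.2⟩
    exact ((differentiableWithinAt_id.sub_const p).mul (hGz.mono fun w hw => ⟨hballV hw.1, hw.2⟩))
  have hfb : BddAbove (norm ∘ f '' (Metric.ball p δ \ {p})) := by
    refine ⟨‖r‖ + 1, ?_⟩
    rintro _ ⟨z, hz, rfl⟩
    have h1 := hU₁sub z ⟨hballU hz.1, hz.2⟩
    have : ‖f z‖ ≤ ‖r‖ + ‖f z - r‖ := by
      have := norm_add_le r (f z - r); rwa [add_sub_cancel] at this
    simp only [Function.comp_apply]
    linarith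
  have hupd := Complex.differentiableOn_update_limUnder_of_bddAbove (Metric.ball_mem_nhds p hδ) hfd hfb
  refine ⟨Metric.ball p δ, Metric.ball_mem_nhds p hδ, hupd, fun z _ hzp => ?_, ?_⟩
  · rw [Function.update_of_ne hzp, zero_add, pow_one, hf]
    simp only
    rw [mul_div_cancel_left₀ _ (sub_ne_zero.mpr hzp)]
  · rw [Function.update_self, hlim.limUnder_eq]

/-- **The contour shift with explicit error, residues as punctured limits** (the typed shape of
`calR1`/`calR2`): under the size hypotheses of `norm_lineIntegral_sub_residues_le`, with `G = Φ·K`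
differentiable on `U ∖ S` and, at each `p ∈ S`, `(z − p)·G(z)` convergent as `z → p` (`z ≠ p`) — i.e.
every singularity in the rectangle is at most a simple pole —,
`‖(1/2π)∫_ℝ G(σ₀+it)dt − Σ_{p∈S} limUnder (𝓝[≠] p) ((z−p)·G)‖ ≤ (1/2π)·(E_tails + E_left + 2E_horiz)`.
For (15.15): `S = {−β₁, −β₂, −β₃, ρ̃−1}`, and `limUnder (𝓝[≠] (−βⱼ)) ((z+βⱼ)·F1516·ℳ₁d^{−z})` is
`ℛ₁ⱼ·d^{βⱼ}ℳ₁(d,l;1−βⱼ)` by the limit laws. [cite: Zhang2022LandauSiegel, §15 (15.15)–(15.16) p.85]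
[cite: MontgomeryVaughan2007, §6.2] -/
theorem norm_lineIntegral_sub_sum_limUnder_le (hΛ : 0 < Λ) (hY : 0 < Y)
    {a σ₀ H M₀ M₁ M₂ : ℝ}
    (haσ : a < σ₀) (hH : |β.im| < H) (ha : a + β.re ≠ 0) (hσ₀ : σ₀ + β.re ≠ 0)
    (hM₀ : 0 ≤ M₀) (hM₁ : 0 ≤ M₁) (hM₂ : 0 ≤ M₂)
    (hΦ₀ : ∀ t : ℝ, H ≤ |t| → ‖Φ ((σ₀ : ℂ) + t * I)‖ ≤ M₀)
    (hΦ₁ : ∀ t : ℝ, |t| ≤ H → ‖Φ ((a : ℂ) + t * I)‖ ≤ M₁)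
    (hΦ₂ : ∀ u : ℝ, a ≤ u → u ≤ σ₀ →
      ‖Φ ((u : ℂ) + (H : ℂ) * I)‖ ≤ M₂ ∧ ‖Φ ((u : ℂ) + ((-H : ℝ) : ℂ) * I)‖ ≤ M₂)
    (hint : Integrable fun t : ℝ => Φ ((σ₀ : ℂ) + t * I) *
        ((Y : ℂ) ^ ((σ₀ : ℂ) + t * I + β) * omega1 Λ ((σ₀ : ℂ) + t * I + β) / ((σ₀ : ℂ) + t * I + β)))
    (S : Finset ℂ) (U : Set ℂ) (hU : IsOpen U)
    (hKU : Icc a σ₀ ×ℂ Icc (-H) H ⊆ U) (hS : (S : Set ℂ) ⊆ Ioo a σ₀ ×ℂ Ioo (-H) H)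
    (hG : DifferentiableOn ℂ (fun s => Φ s *
        ((Y : ℂ) ^ (s + β) * omega1 Λ (s + β) / (s + β))) (U \ ↑S))
    (hlim : ∀ p ∈ S, ∃ r : ℂ, Tendsto (fun z => (z - p) * (Φ z *
        ((Y : ℂ) ^ (z + β) * omega1 Λ (z + β) / (z + β)))) (𝓝[≠] p) (𝓝 r)) :
    ‖(1 / (2 * π) : ℂ) * (∫ t : ℝ, Φ ((σ₀ : ℂ) + t * I) *
        ((Y : ℂ) ^ ((σ₀ : ℂ) + t * I + β) * omega1 Λ ((σ₀ : ℂ) + t * I + β) / ((σ₀ : ℂ) + t * I + β))) -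
        ∑ p ∈ S, limUnder (𝓝[≠] p) (fun z => (z - p) * (Φ z *
          ((Y : ℂ) ^ (z + β) * omega1 Λ (z + β) / (z + β))))‖ ≤
      1 / (2 * π) *
        (2 * (M₀ * (Y ^ (σ₀ + β.re) * rexp ((σ₀ + β.re) ^ 2 / (4 * Λ)) / |σ₀ + β.re|) *
            (gauss (4 * Λ)⁻¹ (H - |β.im|) * (Real.sqrt (4 * π * Λ) / 2))) +
          M₁ * (Y ^ (a + β.re) * rexp ((a + β.re) ^ 2 / (4 * Λ)) / |a + β.re|) *
            Real.sqrt (4 * π * Λ) +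
          2 * ((σ₀ - a) * (M₂ * (max (Y ^ (a + β.re)) (Y ^ (σ₀ + β.re)) *
            rexp (max ((a + β.re) ^ 2) ((σ₀ + β.re) ^ 2) / (4 * Λ)) *
            gauss (4 * Λ)⁻¹ (H - |β.im|) / (H - |β.im|))))) := by
  classical
  set G : ℂ → ℂ := fun s => Φ s * ((Y : ℂ) ^ (s + β) * omega1 Λ (s + β) / (s + β)) with hGdef
  -- the pole data: `φ p = update ((z-p)·G) p (limUnder …)`
  set φ : ℂ → ℂ → ℂ := fun p =>
    Function.update (fun z => (z - p) * G z) p (limUnder (𝓝[≠] p) fun z => (z - p) * G z) with hφdef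
  -- at each pole, a punctured neighbourhood inside `U ∖ S`
  have hpunct : ∀ p ∈ S, (U \ ↑(S.erase p)) ∈ 𝓝 p ∧ DifferentiableOn ℂ G ((U \ ↑(S.erase p)) \ {p}) := by
    intro p hp
    have hpU : p ∈ U := hKU ⟨⟨(hS hp).1.1.le, (hS hp).1.2.le⟩, ⟨(hS hp).2.1.le, (hS hp).2.2.le⟩⟩
    have hopen : IsOpen (U \ ↑(S.erase p)) := hU.sdiff (Finset.finite_toSet _).isClosed
    have hmem : p ∈ U \ ↑(S.erase p) := ⟨hpU, by simp⟩
    refine ⟨hopen.mem_nhds hmem, hG.mono ?_⟩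
    intro z hz
    refine ⟨hz.1.1, fun hzS => ?_⟩
    have hz1 : z ∉ (S.erase p : Set ℂ) := hz.1.2
    have hz2 : z ≠ p := hz.2
    exact hz1 (Finset.mem_coe.mpr (Finset.mem_erase.mpr ⟨hz2, hzS⟩))
  have hpole : ∀ p ∈ S, ∃ V ∈ 𝓝 p, DifferentiableOn ℂ (φ p) V ∧
      ∀ z ∈ V, z ≠ p → Φ z * ((Y : ℂ) ^ (z + β) * omega1 Λ (z + β) / (z + β)) =
        φ p z / (z - p) ^ ((fun _ : ℂ => 0) p + 1) := by
    intro p hp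
    obtain ⟨r, hr⟩ := hlim p hp
    obtain ⟨W, hW, hd, heq, -⟩ := exists_simplePole_datum_of_tendsto (hpunct p hp).1 (hpunct p hp).2 hr
    exact ⟨W, hW, hd, fun z hz hzp => heq z hz hzp⟩
  have h := norm_lineIntegral_sub_residues_le (Φ := Φ) hΛ hY haσ hH ha hσ₀ hM₀ hM₁ hM₂ hΦ₀ hΦ₁ hΦ₂
    hint S (fun _ => 0) φ U hU hKU hS hG hpole
  have hres : ∀ p ∈ S, (Function.swap dslope p)^[(fun _ : ℂ => 0) p] (φ p) p =
      limUnder (𝓝[≠] p) (fun z => (z - p) * G z) := by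
    intro p _
    simp only [Function.iterate_zero, id_eq, hφdef, Function.update_self]
  rw [Finset.sum_congr rfl hres] at h
  exact h

end LimUnder

/-! ### Plumbing for consumers: holomorphy of `Φ·K` off the poles and the punctured limits at the poles

With these, the hypotheses `hG`/`hlim` of `norm_lineIntegral_sub_sum_limUnder_le` reduce to statements
about the consumer's prefactor `Φ` alone (the kernel's own pole `−β` contributes the residue `Φ(−β)`). -/

section KernelPlumbing

variable {Λ Y : ℝ} {β : ℂ} {Φ : ℂ → ℂ}

/-- **`Φ·K` is holomorphic where `Φ` is, away from `−β`**: if `Φ` is differentiable on a set `W` on which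
`s + β ≠ 0`, so is `s ↦ Φ(s)·Y^{s+β}ω₁(s+β)/(s+β)` (`Y > 0`). [cite: Zhang2022LandauSiegel, §4 (4.1) pp.17–18] -/
theorem differentiableOn_mul_kernel (hY : 0 < Y) (Λ : ℝ) {W : Set ℂ} (hβ : ∀ s ∈ W, s + β ≠ 0)
    (hΦ : DifferentiableOn ℂ Φ W) :
    DifferentiableOn ℂ (fun s => Φ s * ((Y : ℂ) ^ (s + β) * omega1 Λ (s + β) / (s + β))) W :=
  fun s hs => (hΦ s hs).mul (differentiableAt_kernel hY Λ (hβ s hs)).differentiableWithinAt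

/-- The same on `U ∖ S` when the kernel's pole `−β` is one of the excluded points `S` (the format of
`norm_lineIntegral_sub_residues_le`). [cite: Zhang2022LandauSiegel, §4 (4.1) pp.17–18] -/
theorem differentiableOn_mul_kernel_sdiff (hY : 0 < Y) (Λ : ℝ) {U : Set ℂ} {S : Finset ℂ}
    (hβ : -β ∈ S) (hΦ : DifferentiableOn ℂ Φ (U \ ↑S)) :
    DifferentiableOn ℂ (fun s => Φ s * ((Y : ℂ) ^ (s + β) * omega1 Λ (s + β) / (s + β))) (U \ ↑S) := by
  refine differentiableOn_mul_kernel hY Λ (fun s hs h => ?_) hΦ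
  have hs' : s = -β := by linear_combination h
  exact hs.2 (by rw [hs']; exact_mod_cast hβ)

/-- **The punctured limit at the kernel's pole**: if `Φ` is continuous at `−β` then
`(z − (−β))·Φ(z)K(z) → Φ(−β)` as `z → −β`, `z ≠ −β` (`Y^0ω₁(0) = 1`): the residue of `Φ·K` at `s = −β`
is `Φ(−β)` — in (15.15) the term `ℛ₁₃` (pole of `(s+β₃)⁻¹`), in (16.10) the term `ℛ₂₂`.
[cite: Zhang2022LandauSiegel, §15 (15.16) p.85] -/
theorem tendsto_sub_mul_kernel_at_neg (hY : 0 < Y) (Λ : ℝ) (hΦ : ContinuousAt Φ (-β)) :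
    Tendsto (fun z => (z - -β) * (Φ z * ((Y : ℂ) ^ (z + β) * omega1 Λ (z + β) / (z + β))))
      (𝓝[≠] (-β)) (𝓝 (Φ (-β))) := by
  have hN : ContinuousAt (fun z : ℂ => (Y : ℂ) ^ (z + β) * omega1 Λ (z + β)) (-β) :=
    (differentiable_kernel_num hY Λ β (-β)).continuousAt
  have hlim : Tendsto (fun z => Φ z * ((Y : ℂ) ^ (z + β) * omega1 Λ (z + β))) (𝓝[≠] (-β))
      (𝓝 (Φ (-β) * ((Y : ℂ) ^ (-β + β) * omega1 Λ (-β + β)))) :=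
    ((hΦ.mul hN).tendsto).mono_left nhdsWithin_le_nhds
  rw [kernel_num_at_neg, mul_one] at hlim
  refine hlim.congr' ?_
  filter_upwards [self_mem_nhdsWithin] with z hz
  have hzβ : z + β ≠ 0 := by
    intro h
    exact hz (by
      simp only [Set.mem_singleton_iff]
      linear_combination h)
  rw [sub_neg_eq_add]
  field_simp

/-- **The punctured limit at a pole of `Φ` away from `−β`**: if `(z − p)Φ(z) → r` as `z → p`, `z ≠ p`,
and `p + β ≠ 0`, then `(z − p)·Φ(z)K(z) → r·K(p)` (`K` is continuous at `p`) — in (15.15)/(16.10) the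
poles `−β₁, −β₂` of `ζ(1+s+βₖ)` (`r` from Mathlib's `riemannZeta_residue_one`, cf. the tree's
`ResidueValues.tendsto_add_mul_zeta`), `ρ̃ − 1` of `1/L(1+s,χ)`, and the removable point `s = 0` of the
literal `1/ζ(1+s)` (`r = 0`). [cite: Zhang2022LandauSiegel, §15 (15.16) p.85] -/
theorem tendsto_sub_mul_kernel_of_tendsto (hY : 0 < Y) (Λ : ℝ) {p r : ℂ} (hp : p + β ≠ 0)
    (hΦ : Tendsto (fun z => (z - p) * Φ z) (𝓝[≠] p) (𝓝 r)) :
    Tendsto (fun z => (z - p) * (Φ z * ((Y : ℂ) ^ (z + β) * omega1 Λ (z + β) / (z + β))))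
      (𝓝[≠] p) (𝓝 (r * ((Y : ℂ) ^ (p + β) * omega1 Λ (p + β) / (p + β)))) := by
  have hK : ContinuousAt (fun z : ℂ => (Y : ℂ) ^ (z + β) * omega1 Λ (z + β) / (z + β)) p :=
    (differentiableAt_kernel hY Λ hp).continuousAt
  have h := hΦ.mul (hK.tendsto.mono_left nhdsWithin_le_nhds)
  refine h.congr fun z => ?_
  ring

end KernelPlumbing

/-! ### Moving the whole line across a pole-free strip (no residues)

For the THIN RANGE of (15.17) (where «`P₄/d > T`» fails) the line `Re s = 1` of (15.14) is moved to
`Re s = 𝓛⁻⁹` without crossing any pole; only the size of the integral on the new line is then needed.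
The Gaussian kernel makes the horizontal decay automatic, so the tree's pole-free shift
`Literature.Analysis.Complex.integral_vertical_eq_of_differentiableOn` applies as soon as `Φ` is
holomorphic and bounded on the closed strip. -/

section FullLine

variable {Λ Y : ℝ} {β : ℂ} {Φ : ℂ → ℂ}

/-- **Size of the whole-line integral**: if `‖Φ(a+it)‖ ≤ M` for all `t` (`a' = a + Re β ≠ 0`), then
`‖∫_ℝ Φ(a+it)K(a+it)dt‖ ≤ M·Y^{a'}e^{a'²/(4Λ)}|a'|⁻¹·√(4πΛ)` (the Gaussian integrates to `√(4πΛ)`).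
[cite: MontgomeryVaughan2007, §5.1 (5.15)–(5.16)] -/
theorem norm_lineIntegral_le (hΛ : 0 < Λ) (hY : 0 < Y) {a M : ℝ} (ha : a + β.re ≠ 0) (hM : 0 ≤ M)
    (hΦ : ∀ t : ℝ, ‖Φ ((a : ℂ) + t * I)‖ ≤ M) :
    ‖∫ t : ℝ, Φ ((a : ℂ) + t * I) *
        ((Y : ℂ) ^ ((a : ℂ) + t * I + β) * omega1 Λ ((a : ℂ) + t * I + β) / ((a : ℂ) + t * I + β))‖ ≤
      M * (Y ^ (a + β.re) * rexp ((a + β.re) ^ 2 / (4 * Λ)) / |a + β.re|) *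
        Real.sqrt (4 * π * Λ) := by
  have hΛ₀ : 0 < (4 * Λ)⁻¹ := by positivity
  set C₀ : ℝ := Y ^ (a + β.re) * rexp ((a + β.re) ^ 2 / (4 * Λ)) / |a + β.re| with hC₀
  have hC₀0 : 0 ≤ C₀ := by rw [hC₀]; positivity
  set g : ℝ → ℝ := fun t => M * C₀ * gauss (4 * Λ)⁻¹ (t + β.im) with hg
  have hgi : Integrable g := ((integrable_gauss hΛ₀).comp_add_right β.im).const_mul (M * C₀)
  have hb : ∀ᵐ t : ℝ, ‖Φ ((a : ℂ) + t * I) *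
      ((Y : ℂ) ^ ((a : ℂ) + t * I + β) * omega1 Λ ((a : ℂ) + t * I + β) / ((a : ℂ) + t * I + β))‖ ≤
        g t := by
    refine Eventually.of_forall fun t => ?_
    rw [norm_mul, hg]
    calc ‖Φ ((a : ℂ) + t * I)‖ *
          ‖((Y : ℂ) ^ ((a : ℂ) + t * I + β) * omega1 Λ ((a : ℂ) + t * I + β) / ((a : ℂ) + t * I + β))‖
        ≤ M * (C₀ * gauss (4 * Λ)⁻¹ (t + β.im)) :=
          mul_le_mul (hΦ t) (norm_kernel_line_le hY Λ β ha t) (norm_nonneg _) hM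
      _ = M * C₀ * gauss (4 * Λ)⁻¹ (t + β.im) := by ring
  refine (norm_integral_le_of_norm_le hgi hb).trans (le_of_eq ?_)
  simp only [hg]
  rw [MeasureTheory.integral_const_mul]
  erw [integral_add_right_eq_self (fun u => gauss (4 * Λ)⁻¹ u) β.im]
  rw [integral_gauss_inv, hC₀]

/-- **Moving the line `Re s = b` to `Re s = a` across a pole-free strip.** If `Φ` is complex
differentiable on the closed strip `a ≤ Re s ≤ b` with `‖Φ‖ ≤ M` there, and the kernel's pole `−β` is
off the strip (`s + β ≠ 0` on it; in particular `a + Re β ≠ 0 ≠ b + Re β`), then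
`∫_ℝ Φ(b+it)K(b+it)dt = ∫_ℝ Φ(a+it)K(a+it)dt` (`Λ, Y > 0`) — the decay on the horizontal segments
`[a,b] ± iT` is supplied by the Gaussian (`norm_kernel_horizontal_le`).
[cite: MontgomeryVaughan2007, §5.1 (5.15)–(5.16)] -/
theorem lineIntegral_eq_of_differentiableOn (hΛ : 0 < Λ) (hY : 0 < Y) {a b M : ℝ} (hab : a ≤ b)
    (ha : a + β.re ≠ 0) (hb : b + β.re ≠ 0)
    (hβ : ∀ s : ℂ, a ≤ s.re → s.re ≤ b → s + β ≠ 0)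
    (hΦd : DifferentiableOn ℂ Φ (re ⁻¹' Icc a b))
    (hM : ∀ s : ℂ, a ≤ s.re → s.re ≤ b → ‖Φ s‖ ≤ M) :
    ∫ t : ℝ, Φ ((b : ℂ) + t * I) *
        ((Y : ℂ) ^ ((b : ℂ) + t * I + β) * omega1 Λ ((b : ℂ) + t * I + β) / ((b : ℂ) + t * I + β)) =
      ∫ t : ℝ, Φ ((a : ℂ) + t * I) *
        ((Y : ℂ) ^ ((a : ℂ) + t * I + β) * omega1 Λ ((a : ℂ) + t * I + β) / ((a : ℂ) + t * I + β)) := by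
  have hM0 : 0 ≤ M := le_trans (norm_nonneg _) (hM (a : ℂ) (by simp) (by simpa using hab))
  -- continuity of `Φ` along the two lines (from differentiability on the strip)
  have hcont : ∀ σ : ℝ, a ≤ σ → σ ≤ b → Continuous fun t : ℝ => Φ ((σ : ℂ) + t * I) := by
    intro σ h1 h2
    have hline : Continuous fun t : ℝ => (σ : ℂ) + t * I := by fun_prop
    refine hΦd.continuousOn.comp_continuous hline fun t => ?_
    simp only [mem_preimage, add_re, ofReal_re, mul_re, I_re, mul_zero, ofReal_im, I_im, mul_one,
      sub_self, add_zero, mem_Icc]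
    exact ⟨h1, h2⟩
  have hMline : ∀ σ : ℝ, a ≤ σ → σ ≤ b → ∀ t : ℝ, ‖Φ ((σ : ℂ) + t * I)‖ ≤ M := by
    intro σ h1 h2 t
    exact hM _ (by simp [h1]) (by simp [h2])
  have hinta := integrable_line (β := β) (Y := Y) hΛ hY ha (hcont a le_rfl hab) (hMline a le_rfl hab)
  have hintb := integrable_line (β := β) (Y := Y) hΛ hY hb (hcont b hab le_rfl) (hMline b hab le_rfl)
  -- holomorphy of `Φ·K` on the strip
  have hGd : DifferentiableOn ℂ (fun s => Φ s *
      ((Y : ℂ) ^ (s + β) * omega1 Λ (s + β) / (s + β))) (re ⁻¹' Icc a b) :=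
    differentiableOn_mul_kernel hY Λ (fun s hs => hβ s hs.1 hs.2) hΦd
  -- decay on horizontals: the Gaussian
  have hdecay : ∀ ε : ℝ, 0 < ε → ∃ T₀ : ℝ, ∀ T : ℝ, T₀ ≤ |T| → ∀ x ∈ Icc a b,
      ‖Φ (x + T * I) * ((Y : ℂ) ^ (x + T * I + β) * omega1 Λ (x + T * I + β) / (x + T * I + β))‖ ≤ ε := by
    intro ε hε
    set A : ℝ := max (Y ^ (a + β.re)) (Y ^ (b + β.re)) *
      rexp (max ((a + β.re) ^ 2) ((b + β.re) ^ 2) / (4 * Λ)) with hA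
    have hA0 : 0 ≤ A := by
      rw [hA]; exact mul_nonneg (le_max_of_le_left (Real.rpow_nonneg hY.le _)) (Real.exp_nonneg _)
    -- `gauss` tends to `0` at infinity; crude: `gauss c u ≤ 1/(c u²)`? Use `exp(-x) ≤ 1/(1+x)`.
    refine ⟨|β.im| + 1 + M * A / ε * (4 * Λ) + 1, fun T hT x hx => ?_⟩
    have hT1 : |β.im| + 1 ≤ |T| := by
      have : 0 ≤ M * A / ε * (4 * Λ) := by positivity
      linarith
    have hTβ : |β.im| < |T| := by linarith
    have hd0 : 0 < |T| - |β.im| := by linarith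
    have hd1 : 1 ≤ |T| - |β.im| := by linarith
    have hK := norm_kernel_horizontal_le (β := β) hΛ hY (a := a) (σ₀ := b) hTβ hx.1 hx.2
    have hΦx : ‖Φ ((x : ℂ) + T * I)‖ ≤ M := hM _ (by simp [hx.1]) (by simp [hx.2])
    rw [norm_mul]
    -- `gauss c d / d ≤ gauss c d ≤ exp(-c d²) ≤ 1/(1 + c d²) ≤ 1/(c d²) ≤ 1/(c d)` for `d ≥ 1`
    have hgauss : gauss (4 * Λ)⁻¹ (|T| - |β.im|) / (|T| - |β.im|) ≤ (4 * Λ) / (|T| - |β.im|) := by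
      rw [div_le_div_iff_of_pos_right hd0, gauss]
      have h1 : Real.exp (-((4 * Λ)⁻¹ * (|T| - |β.im|) ^ 2)) ≤ 1 / (1 + (4 * Λ)⁻¹ * (|T| - |β.im|) ^ 2) := by
        rw [Real.exp_neg, one_div]
        exact inv_anti₀ (by positivity) (by linarith [Real.add_one_le_exp ((4 * Λ)⁻¹ * (|T| - |β.im|) ^ 2)])
      have h2 : 1 / (1 + (4 * Λ)⁻¹ * (|T| - |β.im|) ^ 2) ≤ 4 * Λ := by
        rw [div_le_iff₀ (by positivity)]
        have : (4 * Λ)⁻¹ * (|T| - |β.im|) ^ 2 * (4 * Λ) = (|T| - |β.im|) ^ 2 := by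
          field_simp
        nlinarith [this, hd1]
      have : -((4 * Λ)⁻¹ * (|T| - |β.im|) ^ 2) = -(4 * Λ)⁻¹ * (|T| - |β.im|) ^ 2 := by ring
      rw [← this]
      exact h1.trans h2
    have hKle : ‖(Y : ℂ) ^ ((x : ℂ) + T * I + β) * omega1 Λ ((x : ℂ) + T * I + β) /
        ((x : ℂ) + T * I + β)‖ ≤ A * ((4 * Λ) / (|T| - |β.im|)) := by
      refine hK.trans ?_
      rw [hA, mul_div_assoc]
      exact mul_le_mul_of_nonneg_left hgauss hA0
    have hTbig : M * A * (4 * Λ) / ε ≤ |T| - |β.im| := by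
      have : M * A / ε * (4 * Λ) = M * A * (4 * Λ) / ε := by ring
      linarith
    calc ‖Φ ((x : ℂ) + T * I)‖ * ‖(Y : ℂ) ^ ((x : ℂ) + T * I + β) * omega1 Λ ((x : ℂ) + T * I + β) /
          ((x : ℂ) + T * I + β)‖
        ≤ M * (A * ((4 * Λ) / (|T| - |β.im|))) :=
          mul_le_mul hΦx hKle (norm_nonneg _) hM0
      _ = (M * A * (4 * Λ)) / (|T| - |β.im|) := by ring
      _ ≤ ε := by
          rw [div_le_iff₀ hd0]
          have := (div_le_iff₀ hε).1 hTbig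
          linarith
  exact (Literature.Analysis.Complex.integral_vertical_eq_of_differentiableOn hab hGd hinta hintb
    hdecay).symm

end FullLine

/-! ### Residues as derivatives (poles of higher order: the triple pole of §15 p.87 / §16 p.94) -/

section IteratedDeriv

variable {Λ Y : ℝ} {β : ℂ} {Φ : ℂ → ℂ}

/-- **The contour shift with explicit error, residues as derivatives**: under the hypotheses of
`norm_lineIntegral_sub_residues_le`,
`‖(1/2π)∫_ℝ G(σ₀+it)dt − Σ_{p∈S} φ_p^{(n(p))}(p)/n(p)!‖ ≤ (1/2π)·(E_tails + E_left + 2E_horiz)`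
("`Res_{z=a} f = g^{(m−1)}(a)/(m−1)!` for `f = g/(z−a)^m`", the tree's
`Literature.Analysis.Complex.iterate_dslope_apply_eq_iteratedDeriv_div`) — the shape wanted at the TRIPLE
pole `s = 0` of `ζ(1+s)²·(…)·Tˢω₁(s)/s` (§15 p.87, tex L4359; §16 p.94, tex L4662: `n(0) = 2`, residue
`½φ₀″(0)`). [cite: Zhang2022LandauSiegel, §15 p.87] [cite: Conway1978, Ch. V Prop. 2.4] -/
theorem norm_lineIntegral_sub_residues_le_iteratedDeriv (hΛ : 0 < Λ) (hY : 0 < Y)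
    {a σ₀ H M₀ M₁ M₂ : ℝ}
    (haσ : a < σ₀) (hH : |β.im| < H) (ha : a + β.re ≠ 0) (hσ₀ : σ₀ + β.re ≠ 0)
    (hM₀ : 0 ≤ M₀) (hM₁ : 0 ≤ M₁) (hM₂ : 0 ≤ M₂)
    (hΦ₀ : ∀ t : ℝ, H ≤ |t| → ‖Φ ((σ₀ : ℂ) + t * I)‖ ≤ M₀)
    (hΦ₁ : ∀ t : ℝ, |t| ≤ H → ‖Φ ((a : ℂ) + t * I)‖ ≤ M₁)
    (hΦ₂ : ∀ u : ℝ, a ≤ u → u ≤ σ₀ →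
      ‖Φ ((u : ℂ) + (H : ℂ) * I)‖ ≤ M₂ ∧ ‖Φ ((u : ℂ) + ((-H : ℝ) : ℂ) * I)‖ ≤ M₂)
    (hint : Integrable fun t : ℝ => Φ ((σ₀ : ℂ) + t * I) *
        ((Y : ℂ) ^ ((σ₀ : ℂ) + t * I + β) * omega1 Λ ((σ₀ : ℂ) + t * I + β) / ((σ₀ : ℂ) + t * I + β)))
    (S : Finset ℂ) (n : ℂ → ℕ) (φ : ℂ → ℂ → ℂ) (U : Set ℂ) (hU : IsOpen U)
    (hKU : Icc a σ₀ ×ℂ Icc (-H) H ⊆ U) (hS : (S : Set ℂ) ⊆ Ioo a σ₀ ×ℂ Ioo (-H) H)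
    (hG : DifferentiableOn ℂ (fun s => Φ s *
        ((Y : ℂ) ^ (s + β) * omega1 Λ (s + β) / (s + β))) (U \ ↑S))
    (hpole : ∀ p ∈ S, ∃ V ∈ 𝓝 p, DifferentiableOn ℂ (φ p) V ∧
        ∀ z ∈ V, z ≠ p → Φ z *
            ((Y : ℂ) ^ (z + β) * omega1 Λ (z + β) / (z + β)) = φ p z / (z - p) ^ (n p + 1)) :
    ‖(1 / (2 * π) : ℂ) * (∫ t : ℝ, Φ ((σ₀ : ℂ) + t * I) *
        ((Y : ℂ) ^ ((σ₀ : ℂ) + t * I + β) * omega1 Λ ((σ₀ : ℂ) + t * I + β) / ((σ₀ : ℂ) + t * I + β))) -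
        ∑ p ∈ S, iteratedDeriv (n p) (φ p) p / ((n p).factorial : ℂ)‖ ≤
      1 / (2 * π) *
        (2 * (M₀ * (Y ^ (σ₀ + β.re) * rexp ((σ₀ + β.re) ^ 2 / (4 * Λ)) / |σ₀ + β.re|) *
            (gauss (4 * Λ)⁻¹ (H - |β.im|) * (Real.sqrt (4 * π * Λ) / 2))) +
          M₁ * (Y ^ (a + β.re) * rexp ((a + β.re) ^ 2 / (4 * Λ)) / |a + β.re|) *
            Real.sqrt (4 * π * Λ) +
          2 * ((σ₀ - a) * (M₂ * (max (Y ^ (a + β.re)) (Y ^ (σ₀ + β.re)) *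
            rexp (max ((a + β.re) ^ 2) ((σ₀ + β.re) ^ 2) / (4 * Λ)) *
            gauss (4 * Λ)⁻¹ (H - |β.im|) / (H - |β.im|))))) := by
  have h := norm_lineIntegral_sub_residues_le (Φ := Φ) hΛ hY haσ hH ha hσ₀ hM₀ hM₁ hM₂ hΦ₀ hΦ₁ hΦ₂
    hint S n φ U hU hKU hS hG hpole
  have hres : ∀ p ∈ S, (Function.swap dslope p)^[n p] (φ p) p =
      iteratedDeriv (n p) (φ p) p / ((n p).factorial : ℂ) := by
    intro p hp
    obtain ⟨V, hV, hφ, -⟩ := hpole p hp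
    exact Literature.Analysis.Complex.iterate_dslope_apply_eq_iteratedDeriv_div hV hφ (n p)
  rw [Finset.sum_congr rfl hres] at h
  exact h

end IteratedDeriv

end Literature.NumberTheory.LFunctions.Zhang2022.GaussKernelContour
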